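/-
Copyright (c) 2026. Released under the Apache 2.0 license.
NS-CLAIMS SWEEP (D-0090) — C136 `PaiLimsuwan2026` (T3 QUICK, RULINGS v1.31i (1)). SKELETON (conv. (a)).
-/
import Mathlib
import Literature.Claims.NS.ClayVariants
import Literature.Claims.NS.ClayR3EnstrophyBridge
import Literature.Analysis.FluidPDE.SobolevWholeSpace
import Literature.Analysis.FluidPDE.ClassicalNSFiniteEnergyEquality
import Literature.Analysis.FluidPDE.TaoLocalisationHolds
import Literature.Analysis.FluidPDE.NSCriticalClosureBesovKatoClass
import Literature.Analysis.FluidPDE.KatoCaloricField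
import Literature.Analysis.FluidPDE.TaoClassSliceData
import Literature.Analysis.FluidPDE.ConstantinFeffermanEnstrophySlab
import Literature.Analysis.FluidPDE.FiniteEnergyClassicalL2Decay
import HarnessLib

/-!
# Claim skeleton C136 — «PAI; Yoon A Limsuwan» (MSPS NETWORK), «Structural Calculus Framework: Global
# Existence and Smoothness of 3D Navier-Stokes Equations» (Thai title, English subtitle), Zenodo
# doi:10.5281/zenodo.22107318 (2026-08-26, 4 pp.; PDF page = printed page)

UNREFEREED CLAIM under adjudication (cell `ns-claims`, D-0090) — NOTHING HERE ASSERTS A STEP: every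
printed assertion is a `def … : Prop`; the only `theorem`s are kernel-checked relations between them and
theorems of the tree. Text of record: the census pin `census/texts/PaiLimsuwan2026/` (PDF sha16
8619ea44fac01eb5; lit lane `sources/PaiLimsuwan2026/`, ns-claims-lit-1 g7). Provenance printed p.1
(«Work With Gemini, Claude, GPT») is recorded on the CARD only. Same-day companion deposit
doi:10.5281/zenodo.22109184 (158 pp.) restates the argument as CONDITIONAL (lineage cell on the CARD).

CLAIMED STATEMENT (p.3, «ทฤษฎีบท (Theorem) 3.1 (Global Smoothness & Non-Singularity)» with §4
«Conclusion & Final Proof»): for the system (1.1) `∂ₜu + (u·∇)u = −∇p + νΔu + f`, (1.2) `∇·u = 0`,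
(1.3) `u(·,0) = u₀`, on `ℝ³` (p.2), «1. Global Existence: for `u₀ ∈ ℋᵏ(ℝ³)`, `k ≥ 3`, the system has a
solution `u(x,t)` existing continuously on `t ∈ [0,∞)`; 2. Smoothness: `u, p ∈ C^∞(ℝ³ × (0,∞))`;
3. Decay: `lim_{t→∞} ‖u(t)‖_{L²} = 0`» — via (3.4) «`𝒬(t) ≤ 𝒬(0)·exp(C₁∫₀ᵗ‖∇u(s)‖⁴_{L²} ds) < ∞
∀ t ∈ [0,∞)` (No Finite-Time Blow-up)». From (2.4) on («ในกรณีระบบปิดไร้แรงภายนอก (f = 0)», p.2)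
the whole analysis is printed for `f = 0`; typed so (Δ3 note below). Direction: REGULARITY.

CLAY DELTA (reference `ClayVariants.lean`, (A) = `clayR3.Regularity`): domain `ℝ³` «=»; force: (1.1)
carries `f`, the analysis and (2.4) take `f = 0` «=» for (A) (the forced sentence is not argued — Δ3
note only); data `ℋᵏ(ℝ³)`, `k ≥ 3` ⊋ Clay (4) — good direction (typed below at the Clay class, a
SPECIAL CASE of the print); solution class: item 2 prints `C^∞(ℝ³ × (0,∞))` — the OPEN half-space, no
bounded-energy clause (7) in the sentence (Δ5/Δ6 as in C93 `Nwankpa2025`): `clay_of_claimed` is NOT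
provable verbatim; but the printed ROUTE goes through an a priori enstrophy bound (3.4), which IS (A) by
the tree's `ClayVariants.clayR3_regularity_iff_aprioriEnstrophyBound` — so `clay_of_steps` below is
PROVED with no delta. Viscosity `ν > 0` «=»; horizon `[0,∞)` «=».

STEPS (print order; locators read on the pinned pages p.2–3):
* Step 1 `Step1_Energy24` — (2.4) p.2: `‖u(t)‖² + 2ν∫₀ᵗ‖∇u‖² ≤ ‖u(0)‖² < ∞` (`f = 0`). True by literature
  for the finite-energy classical solutions typed here (energy identity).
* Step 2 `Step2_Enstrophy31` — (3.1) p.2: `d/dt 𝒬 + ν‖∇ω‖² = ∫ ω·(𝒯(u)ω)`, `𝒬 = ½‖ω‖²`, `𝒯(u) = ½(∇u+∇uᵀ)`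
  (2.2). True by literature (`f = 0`, decaying smooth slices).
* Step 3 `Step3_Stretch32` — (3.2) p.3: `|∫ ω·(𝒯(u)ω)| ≤ C‖∇u‖_{L²}‖ω‖²_{L⁴}`. Functions grain; true
  (Cauchy–Schwarz, `C = 1`).
* Step 4 `Step4_GN` — p.3 l.5: `‖ω‖_{L⁴} ≤ C₀‖ω‖_{L²}^{1/4}‖∇ω‖_{L²}^{3/4}` (Gagliardo–Nirenberg, `ℝ³`).
  Functions grain; true (classical).
* Step 5 `Step5_Closed33` — (3.3) p.3 l.7 AS PRINTED: `d/dt 𝒬 + ν‖∇ω‖² ≤ C₁‖∇u‖⁴_{L²}𝒬` («closed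
  differential inequality»). Typist's flag: SUSPICIOUS as printed — by (3.1) it says
  `∫ω·(𝒯(u)ω) ≤ C₁‖∇u‖⁴𝒬` with the dissipation unspent (degree 3 vs 6 in the amplitude); the standard
  Young step yields instead `d/dt 𝒬 ≤ C₁(ν)‖∇u‖⁴𝒬` = `Step5C_Closed33corr` (charitable corrected form,
  true by literature); functions face `Step5F_Closed33fun` (kernel handle: amplitude scaling).
* Step 6 `Step6_Gronwall34` — (3.4) p.3 l.8–9, the INEQUALITY: `𝒬(t) ≤ 𝒬(0)exp(C₁∫₀ᵗ‖∇u‖⁴)`. True by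
  literature (from 5C + Grönwall).
* Step 7 `Step7_ExpFinite24` — (3.4) p.3 l.8–10, the clause «`< ∞ ∀ t ∈ [0,∞)`» obtained «by Grönwall
  TOGETHER WITH the energy inequality (2.4)» («No Finite-Time Blow-up»): for every finite-energy
  classical solution on a half-open slab `[0,T)` the exponent `∫₀ᵗ‖∇u‖⁴_{L²}` stays BOUNDED on
  `[0,T)`. THE LOAD-BEARING INFERENCE (the locator predicted by census, chair and CARD): (2.4) bounds
  `∫₀^∞‖∇u‖²_{L²}` only; `∫‖∇u‖⁴_{L²} < ∞` is an `L⁴_t Ḣ¹ ⊂ L⁴_t L⁶_x` (Serrin `2/4 + 3/6 = 1`) a priori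
  bound, scale-critical — undecided at the solutions grain (it is the open problem's strength). Its
  real-variable face `Step7A_L1toL2_abs` («a uniform `L¹` bound on `g = ‖∇u‖²` on `[0,T)` bounds
  `∫ g²`») is typed for the refuter (false on paper: `g(s) = (T−s)^{−1/2}`).
* Step 8 — §4 items 1–2 from the a priori enstrophy bound: a THEOREM of the tree
  (`clayR3_regularity_iff_aprioriEnstrophyBound`; Leray 1934 §20/§33, Constantin–Fefferman 1993), used
  inside `clay_of_steps` — no Step fact (lit-4 g5 rule).
* Step 9 `Step9_Decay` — §4 item 3 p.3 «`lim ‖u(t)‖_{L²} = 0`», no derivation printed; typed for the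
  (A)-class solution; true by literature (Masuda 1984 / Wiegner 1987 for finite-energy solutions with
  the energy inequality; Tao 2013 Cor. 11.1 puts the (A)-solution in that class); off the (A) path.

COMPOSITION: PROVED — `apriori_enstrophy_of_steps : Step6 → Step7 → (a priori enstrophy bound)`,
`clay_of_steps : Step6 → Step7 → clayR3.Regularity` (tree bridge), `claim_of_steps : Step6 → Step7 →
Step9 → ClaimedTheorem`. Steps 1–5 are the printed derivation of Step 6 (recorded, each decidable alone).
`clay_of_claimed : ClaimedTheorem → clayR3.Regularity` is NOT provable verbatim (Δ5/Δ6) and not drafted.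

WHAT THIS IS NOT: not a claim about NS regularity or blow-up; not a claim about any author beyond the
typed locator.
-/

open scoped ContDiff ENNReal Topology
open Set MeasureTheory Filter

namespace Literature.Claims.NS.PaiLimsuwan2026

open Literature.Analysis Literature.Analysis.FluidPDE Literature.Claims.NS.ClayVariants

/-- `ℝ³` (plumbing). [folklore] -/
abbrev E3 := EuclideanSpace ℝ (Fin 3)

/-! ## The functionals of p.2–3 (time slices of a field `u : ℝ → ℝ³ → ℝ³`) -/

/-- `‖u(t)‖²_{ℒ²}` ((2.3)–(2.4) p.2). [cite: PaiLimsuwan2026, (2.4) p.2] -/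
noncomputable def energy (u : ℝ → E3 → E3) (t : ℝ) : ℝ := ∫ x, ‖u t x‖ ^ 2

/-- `‖∇u(t)‖²_{ℒ²}` (operator norm of the Fréchet derivative; constants absorb the choice).
[cite: PaiLimsuwan2026, (2.4) p.2] -/
noncomputable def gradsq (u : ℝ → E3 → E3) (t : ℝ) : ℝ := ∫ x, ‖fderiv ℝ (u t) x‖ ^ 2

/-- The enstrophy `𝒬(t) = ½‖ω(t)‖²_{ℒ²} = ½∫|∇ × u|²` (p.2 l.27). [cite: PaiLimsuwan2026, §3 p.2] -/
noncomputable def enstrophy (u : ℝ → E3 → E3) (t : ℝ) : ℝ := (1 / 2) * ∫ x, ‖curl (u t) x‖ ^ 2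

/-- `‖∇ω(t)‖²_{ℒ²}`, `ω = ∇ × u` ((3.1) p.2). [cite: PaiLimsuwan2026, (3.1) p.2] -/
noncomputable def vortgradsq (u : ℝ → E3 → E3) (t : ℝ) : ℝ := ∫ x, ‖fderiv ℝ (curl (u t)) x‖ ^ 2

/-- The strain-rate tensor `𝒯(v) = ½(∇v + (∇v)ᵀ)` at `x` ((2.2) p.2). [cite: PaiLimsuwan2026, (2.2) p.2] -/
noncomputable def strain (v : E3 → E3) (x : E3) : E3 →L[ℝ] E3 :=
  (1 / 2 : ℝ) • (fderiv ℝ v x + ContinuousLinearMap.adjoint (fderiv ℝ v x))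

/-- The vortex-stretching functional `∫ ω·(𝒯(v)ω) dx` of a field `v`, `ω = ∇ × v` ((3.1)–(3.2)).
[cite: PaiLimsuwan2026, (3.1) p.2, (3.2) p.3] -/
noncomputable def stretchF (v : E3 → E3) : ℝ := ∫ x, inner ℝ (curl v x) (strain v x (curl v x))

/-- The same along a time-dependent field: `∫ ω(t)·(𝒯(u(t))ω(t))`. [cite: PaiLimsuwan2026, (3.1) p.2] -/
noncomputable def stretch (u : ℝ → E3 → E3) (t : ℝ) : ℝ := stretchF (u t)

/-! ## The solutions the displays are typed on

(1.1)–(1.3) p.2 on `ℝ³` with `f = 0` (the paper's own restriction from (2.4) on), data in the Clay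
class (a SPECIAL CASE of the printed `u₀ ∈ ℋᵏ(ℝ³)`, `k ≥ 3`), classical on a HALF-OPEN slab `[0,T) × ℝ³`
with finite energy there — token for token the class of the tree's enstrophy bridge
`clayR3_regularity_iff_aprioriEnstrophyBound`, so that «no finite-time blow-up» (p.3 l.10) has its
meaning: a bound that holds up to every candidate blow-up time `T`. -/

/-- A finite-energy classical solution of (1.1)–(1.3) with `f = 0` on `[0,T) × ℝ³` from a Clay datum.
[cite: PaiLimsuwan2026, (1.1)–(1.3) p.2; (2.4) p.2] -/
structure SlabSol (ν T : ℝ) (u₀ : E3 → E3) (u : ℝ → E3 → E3) (p : ℝ → E3 → ℝ) : Prop where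
  visc : 0 < ν
  data_smooth : ContDiff ℝ ∞ u₀
  data_divFree : NSWave0.IsDivFree u₀
  data_decay : HasRapidSpatialDecay u₀
  solves : IsClassicalNSSolutionOn (Ico 0 T) ν 0 u p
  initial : u 0 = u₀
  finiteEnergy : ∃ A : ℝ≥0∞, A < ⊤ ∧ ∀ t ∈ Ico 0 T, ∫⁻ x, ‖u t x‖ₑ ^ 2 ≤ A

/-! ## The claimed statement -/

/-- **§4 «Conclusion & Final Proof» p.3 (with Thm 3.1 p.3)**, items 1–3, typed in the authors' setting
(`ℝ³`, `f = 0` as analysed, Clay data as a special case of `ℋᵏ`, `k ≥ 3`): for every `ν > 0` and every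
smooth divergence-free rapidly decaying `u₀` there are `u, p` solving (1.1)–(1.3) on `ℝ³ × [0,∞)`
(item 1), with `u, p ∈ C^∞(ℝ³ × (0,∞))` (item 2, OPEN half-space as printed) and `‖u(t)‖_{ℒ²} → 0`
(item 3). [cite: PaiLimsuwan2026, §4 p.3; Thm 3.1 p.3] [claim: PaiLimsuwan2026, status: under-review] -/
def ClaimedTheorem : Prop :=
  ∀ ν : ℝ, 0 < ν → ∀ u₀ : E3 → E3, ContDiff ℝ ∞ u₀ → NSWave0.IsDivFree u₀ → HasRapidSpatialDecay u₀ →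
    ∃ (u : ℝ → E3 → E3) (p : ℝ → E3 → ℝ),
      IsNavierStokesSolution ν 0 u₀ u p ∧
      ContDiffOn ℝ ∞ (Function.uncurry u) (Ioi (0 : ℝ) ×ˢ univ) ∧
      ContDiffOn ℝ ∞ (Function.uncurry p) (Ioi (0 : ℝ) ×ˢ univ) ∧
      Tendsto (energy u) atTop (𝓝 0)

/-! ## The steps (print order) -/

/-- **Step 1 — (2.4) p.2** («in the closed system without external force (f = 0)»):
`‖u(t)‖²_{ℒ²} + 2ν∫₀ᵗ‖∇u(s)‖²_{ℒ²} ds ≤ ‖u(0)‖²_{ℒ²} < ∞` for the solutions typed here. True by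
literature (energy identity of finite-energy classical solutions from Clay data). [cite: PaiLimsuwan2026, (2.4) p.2] -/
def Step1_Energy24 : Prop :=
  ∀ (ν T : ℝ) (u₀ : E3 → E3) (u : ℝ → E3 → E3) (p : ℝ → E3 → ℝ), SlabSol ν T u₀ u p →
    ∀ t ∈ Ico 0 T, energy u t + 2 * ν * ∫ s in (0 : ℝ)..t, gradsq u s ≤ energy u 0

/-- **Step 2 — (3.1) p.2**, the enstrophy identity `d/dt 𝒬(t) + ν‖∇ω‖²_{ℒ²} = ∫ ω·(𝒯(u)ω) dx` along the
solutions typed here (`f = 0`), at interior times. True by literature. [cite: PaiLimsuwan2026, (3.1) p.2] -/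
def Step2_Enstrophy31 : Prop :=
  ∀ (ν T : ℝ) (u₀ : E3 → E3) (u : ℝ → E3 → E3) (p : ℝ → E3 → ℝ), SlabSol ν T u₀ u p →
    ∀ t ∈ Ioo 0 T, HasDerivAt (enstrophy u) (stretch u t - ν * vortgradsq u t) t

/-- **Step 3 — (3.2) p.3**, the vortex-stretching bound «by Gagliardo–Nirenberg and Hölder»:
`|∫ ω·(𝒯(v)ω) dx| ≤ C‖∇v‖_{ℒ²}‖ω‖²_{ℒ⁴}`, at the print's FUNCTIONS grain (every smooth rapidly decaying
field; `‖ω‖²_{ℒ⁴} = (∫|ω|⁴)^{1/2}`). True (Cauchy–Schwarz, `C = 1`). [cite: PaiLimsuwan2026, (3.2) p.3] -/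
def Step3_Stretch32 : Prop :=
  ∃ C : ℝ, 0 < C ∧ ∀ v : E3 → E3, ContDiff ℝ ∞ v → HasRapidSpatialDecay v →
    |stretchF v| ≤ C * Real.sqrt (∫ x, ‖fderiv ℝ v x‖ ^ 2) * Real.sqrt (∫ x, ‖curl v x‖ ^ 4)

/-- **Step 4 — p.3 l.5**, Gagliardo–Nirenberg on `ℝ³`: `‖ω‖_{ℒ⁴} ≤ C₀‖ω‖_{ℒ²}^{1/4}‖∇ω‖_{ℒ²}^{3/4}`, i.e.
`∫|w|⁴ ≤ C₀⁴ (∫|w|²)^{1/2} (∫‖∇w‖²)^{3/2}` for smooth rapidly decaying `w : ℝ³ → ℝ³` (functions grain).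
True (classical). [cite: PaiLimsuwan2026, p.3 l.5] -/
def Step4_GN : Prop :=
  ∃ C₀ : ℝ, 0 < C₀ ∧ ∀ w : E3 → E3, ContDiff ℝ ∞ w → HasRapidSpatialDecay w →
    ∫ x, ‖w x‖ ^ 4 ≤ C₀ ^ 4 * (∫ x, ‖w x‖ ^ 2) ^ (1 / 2 : ℝ) * (∫ x, ‖fderiv ℝ w x‖ ^ 2) ^ (3 / 2 : ℝ)

/-- **Step 5 — (3.3) p.3 l.7 AS PRINTED** («closed differential inequality»): there is `C₁ > 0` (its
dependence is not printed; typed charitably per viscosity) with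
`d/dt 𝒬(t) + ν‖∇ω(t)‖²_{ℒ²} ≤ C₁‖∇u(t)‖⁴_{ℒ²}𝒬(t)` along the solutions typed here, at every interior
time where `𝒬` is differentiable with derivative `D`. Typist's flag: suspicious as printed (the
dissipation is kept on the left with nothing on the right to pay for it; cf. `Step5C_Closed33corr`).
[cite: PaiLimsuwan2026, (3.3) p.3] -/
def Step5_Closed33 : Prop :=
  ∀ ν : ℝ, 0 < ν → ∃ C₁ : ℝ, 0 < C₁ ∧
    ∀ (T : ℝ) (u₀ : E3 → E3) (u : ℝ → E3 → E3) (p : ℝ → E3 → ℝ), SlabSol ν T u₀ u p →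
      ∀ t ∈ Ioo 0 T, ∀ D : ℝ, HasDerivAt (enstrophy u) D t →
        D + ν * vortgradsq u t ≤ C₁ * gradsq u t ^ 2 * enstrophy u t

/-- **Step 5, FUNCTIONS face** — (3.3) read through (3.1) at a time slice: `∫ ω·(𝒯(v)ω) ≤ C₁‖∇v‖⁴_{ℒ²}·
½‖∇×v‖²_{ℒ²}` for every smooth divergence-free rapidly decaying field `v` (what (3.3) asserts of the
slice `v = u(t)` once (3.1) is substituted; inhomogeneous of degrees 3 vs 6 under `v ↦ εv`).
Kernel handle for the refuter; not consumed by the composition. [cite: PaiLimsuwan2026, (3.3) with (3.1) p.2–3] -/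
def Step5F_Closed33fun : Prop :=
  ∀ ν : ℝ, 0 < ν → ∃ C₁ : ℝ, 0 < C₁ ∧ ∀ v : E3 → E3, ContDiff ℝ ∞ v → NSWave0.IsDivFree v →
    HasRapidSpatialDecay v →
      stretchF v ≤ C₁ * (∫ x, ‖fderiv ℝ v x‖ ^ 2) ^ 2 * ((1 / 2) * ∫ x, ‖curl v x‖ ^ 2)

/-- **Step 5, CHARITABLE corrected form** — what (3.2) + Step 4 + Young's inequality actually give (the
dissipation spent): `d/dt 𝒬(t) ≤ C₁(ν)‖∇u(t)‖⁴_{ℒ²}𝒬(t)` along the solutions typed here. True by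
literature (`C₁ ∼ ν⁻³`). This, not the literal (3.3), is what Grönwall needs for (3.4).
[cite: PaiLimsuwan2026, (3.2)–(3.3) p.3] -/
def Step5C_Closed33corr : Prop :=
  ∀ ν : ℝ, 0 < ν → ∃ C₁ : ℝ, 0 < C₁ ∧
    ∀ (T : ℝ) (u₀ : E3 → E3) (u : ℝ → E3 → E3) (p : ℝ → E3 → ℝ), SlabSol ν T u₀ u p →
      ∀ t ∈ Ioo 0 T, ∀ D : ℝ, HasDerivAt (enstrophy u) D t → D ≤ C₁ * gradsq u t ^ 2 * enstrophy u t

/-- **Step 6 — (3.4) p.3 l.8–9, the Grönwall INEQUALITY** («applying Grönwall's inequality»):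
`𝒬(t) ≤ 𝒬(0)·exp(C₁∫₀ᵗ‖∇u(s)‖⁴_{ℒ²} ds)` for every solution typed here and every `t ∈ [0,T)`. True by
literature (Step 5C + Grönwall). [cite: PaiLimsuwan2026, (3.4) p.3] -/
def Step6_Gronwall34 : Prop :=
  ∀ ν : ℝ, 0 < ν → ∃ C₁ : ℝ, 0 < C₁ ∧
    ∀ (T : ℝ) (u₀ : E3 → E3) (u : ℝ → E3 → E3) (p : ℝ → E3 → ℝ), SlabSol ν T u₀ u p →
      ∀ t ∈ Ico 0 T,
        enstrophy u t ≤ enstrophy u 0 * Real.exp (C₁ * ∫ s in (0 : ℝ)..t, gradsq u s ^ 2)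

/-- **Step 7 — (3.4) p.3 l.8–10, the clause «`< ∞ ∀ t ∈ [0,∞)`» «together with the energy inequality
(2.4)» («No Finite-Time Blow-up»)** — THE LOAD-BEARING INFERENCE: for every finite-energy classical
solution on a half-open slab `[0,T)` the exponent `∫₀ᵗ‖∇u(s)‖⁴_{ℒ²} ds` stays BOUNDED on `[0,T)` (so that
(3.4) bounds `𝒬` up to the candidate blow-up time `T`). (2.4) supplies only `∫₀^∞‖∇u‖²_{ℒ²} ≤
‖u₀‖²/(2ν)`; the `L⁴_tḢ¹` bound is Serrin-critical. Undecided at this grain (open-problem strength);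
real-variable face: `Step7A_L1toL2_abs`. [cite: PaiLimsuwan2026, (3.4) p.3 l.8–10] -/
def Step7_ExpFinite24 : Prop :=
  ∀ (ν T : ℝ) (u₀ : E3 → E3) (u : ℝ → E3 → E3) (p : ℝ → E3 → ℝ), SlabSol ν T u₀ u p →
    ∃ B : ℝ, ∀ t ∈ Ico 0 T, ∫ s in (0 : ℝ)..t, gradsq u s ^ 2 ≤ B

/-- **Step 7, REAL-VARIABLE face** of the inference «(2.4) ⇒ the exponent of (3.4) is finite»: for a
continuous non-negative `g` on `[0,T)` (`g = ‖∇u‖²_{ℒ²}`), a uniform bound on `∫₀ᵗ g` (what (2.4) gives)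
yields a uniform bound on `∫₀ᵗ g²` (what (3.4) needs). Typed for the refuter (false on paper:
`g(s) = (T − s)^{−1/2}`); not consumed by the composition. [cite: PaiLimsuwan2026, (3.4) with (2.4) p.2–3] -/
def Step7A_L1toL2_abs : Prop :=
  ∀ T : ℝ, 0 < T → ∀ g : ℝ → ℝ, ContinuousOn g (Ico 0 T) → (∀ s ∈ Ico 0 T, 0 ≤ g s) →
    (∃ E : ℝ, ∀ t ∈ Ico 0 T, ∫ s in (0 : ℝ)..t, g s ≤ E) →
      ∃ B : ℝ, ∀ t ∈ Ico 0 T, ∫ s in (0 : ℝ)..t, g s ^ 2 ≤ B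

/-- **Step 9 — §4 item 3 p.3** «Decay Property: `lim_{t→∞} ‖u(t)‖_{ℒ²} = 0`» (no derivation printed),
typed for the (A)-class solutions produced by the route (smooth on the closed half-space, `f = 0`, Clay
datum, bounded energy). True by literature (Masuda 1984 / Wiegner 1987 with Tao 2013 Cor. 11.1); off
the (A) path. [cite: PaiLimsuwan2026, §4 item 3 p.3] -/
def Step9_Decay : Prop :=
  ∀ ν : ℝ, 0 < ν → ∀ (u₀ : E3 → E3) (u : ℝ → E3 → E3) (p : ℝ → E3 → ℝ),
    ContDiff ℝ ∞ u₀ → NSWave0.IsDivFree u₀ → HasRapidSpatialDecay u₀ →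
    IsSmoothOnHalfSpace u → IsSmoothOnHalfSpace p → IsNavierStokesSolution ν 0 u₀ u p →
    HasBoundedEnergy u → Tendsto (energy u) atTop (𝓝 0)

/-! ## Composition (PROVED): Step 6 ∧ Step 7 ⇒ a priori enstrophy bound ⇒ (A) ⇒ the claim (+ Step 9) -/

/-- **Steps 6–7 give the a priori ENSTROPHY bound** in the tree's form: every finite-energy classical
solution of the unforced system on `[0,T) × ℝ³` from a Clay datum has `∫|curl u(t)|² ≤ M` on `[0,T)`
(`M = 2𝒬(0)exp(C₁B)`). Pure bookkeeping (monotonicity of `exp`).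
[cite: PaiLimsuwan2026, (3.4) p.3 «No Finite-Time Blow-up»] -/
theorem apriori_enstrophy_of_steps (h6 : Step6_Gronwall34) (h7 : Step7_ExpFinite24) :
    ∀ μ : ℝ, 0 < μ →
      ∀ (u₀ : E3 → E3), ContDiff ℝ ∞ u₀ → NSWave0.IsDivFree u₀ → HasRapidSpatialDecay u₀ →
        ∀ (T : ℝ) (u : ℝ → E3 → E3) (p : ℝ → E3 → ℝ),
          IsClassicalNSSolutionOn (Ico 0 T) μ 0 u p → u 0 = u₀ →
          (∃ A : ℝ≥0∞, A < ⊤ ∧ ∀ t ∈ Ico 0 T, ∫⁻ x, ‖u t x‖ₑ ^ 2 ≤ A) →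
            ∃ M : ℝ, ∀ t ∈ Ico 0 T, ∫ x, ‖curl (u t) x‖ ^ 2 ≤ M := by
  intro μ hμ u₀ hs hdiv hdec T u p hsol h0 hE
  have hS : SlabSol μ T u₀ u p := ⟨hμ, hs, hdiv, hdec, hsol, h0, hE⟩
  obtain ⟨C₁, hC₁, hG⟩ := h6 μ hμ
  obtain ⟨B, hB⟩ := h7 μ T u₀ u p hS
  refine ⟨2 * (enstrophy u 0 * Real.exp (C₁ * B)), fun t ht => ?_⟩
  have hQ0 : 0 ≤ enstrophy u 0 := by
    unfold enstrophy; exact mul_nonneg (by norm_num) (integral_nonneg fun x => by positivity)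
  have h1 : enstrophy u t ≤ enstrophy u 0 * Real.exp (C₁ * B) :=
    (hG T u₀ u p hS t ht).trans
      (mul_le_mul_of_nonneg_left (Real.exp_le_exp.2
        (mul_le_mul_of_nonneg_left (hB t ht) hC₁.le)) hQ0)
  have h2 : ∫ x, ‖curl (u t) x‖ ^ 2 = 2 * enstrophy u t := by unfold enstrophy; ring
  rw [h2]
  exact mul_le_mul_of_nonneg_left h1 (by norm_num)

/-- **CLAY LINK (PROVED): Steps 6–7 imply Fefferman's (A)** `clayR3.Regularity`, through the tree's
enstrophy bridge `clayR3_regularity_iff_aprioriEnstrophyBound` (the paper's Step 8, «bounded enstrophy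
⇒ no blow-up ⇒ global smooth solution», is that theorem: Leray 1934 §20/§33, Constantin–Fefferman 1993).
[cite: PaiLimsuwan2026, (3.4)–§4 p.3] [cite: FeffermanClay2006, (A) p.2] -/
theorem clay_of_steps (h6 : Step6_Gronwall34) (h7 : Step7_ExpFinite24) : clayR3.Regularity :=
  clayR3_regularity_iff_aprioriEnstrophyBound.2 (apriori_enstrophy_of_steps h6 h7)

/-- **COMPOSITION (PROVED)** in the paper's own logic: (3.4) bounded on every slab (Steps 6–7) ⇒ global
smooth solution (Step 8 = tree theorem) ⇒ items 1–2; item 3 by Step 9. Steps 1–5 are the printed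
derivation of Step 6 and are recorded, not consumed. [cite: PaiLimsuwan2026, §4 p.3] -/
theorem claim_of_steps (h6 : Step6_Gronwall34) (h7 : Step7_ExpFinite24) (h9 : Step9_Decay) :
    ClaimedTheorem := by
  intro ν hν u₀ hs hdiv hdec
  obtain ⟨u, p, hu, hp, hsol, hE⟩ := clay_of_steps h6 h7 ν hν u₀ hs hdiv hdec
  refine ⟨u, p, hsol, hu.mono (prod_mono Ioi_subset_Ici_self le_rfl),
    hp.mono (prod_mono Ioi_subset_Ici_self le_rfl), ?_⟩
  exact h9 ν hν u₀ u p hs hdiv hdec hu hp hsol hE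

/-! ## Kernel certificates for the TRUE functions-grain steps 3 and 4 (APPEND-ONLY)

`step3_Stretch32_holds : Step3_Stretch32` (Cauchy–Schwarz with `‖𝒯(v)‖ ≤ ‖∇v‖`, constant `C = 1`) and
`step4_GN_holds : Step4_GN` (Gagliardo–Nirenberg on `ℝ³`: the whole-space Sobolev inequality
`‖w‖_{L⁶} ≤ K‖∇w‖_{L²}` of the tree, `Literature.Analysis.FluidPDE.eLpNorm_six_le_eLpNorm_fderiv_two`,
no compact support, plus the Cauchy–Schwarz interpolation `∫|w|⁴ ≤ √∫|w|² √∫|w|⁶`; constant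
`C₀ = K + 1`). Both steps are UPSTREAM of the predicted locator (Step 7) and off the kernel composition;
the certificates change no verdict / locator / class / statement (devices as in C93 `Nwankpa2025`). -/

section Certificates

/-- Order-0 decay: `‖v x‖ ≤ C (1+‖x‖)^{-4}` with `C ≥ 0`. (Proof device.) [folklore] -/
private theorem exists_norm_le_of_decay {v : E3 → E3} (hd : HasRapidSpatialDecay v) :
    ∃ C : ℝ, 0 ≤ C ∧ ∀ x, ‖v x‖ ≤ C * (1 + ‖x‖) ^ (-(4 : ℝ)) := by
  obtain ⟨C, hC⟩ := hd 0 4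
  have hC0 : 0 ≤ C := le_trans (by positivity) (hC 0)
  refine ⟨C, hC0, fun x => ?_⟩
  have hx : 0 < 1 + ‖x‖ := by positivity
  have h := hC x
  rw [norm_iteratedFDeriv_zero] at h
  rw [show (-(4 : ℝ)) = -((4 : ℕ) : ℝ) by norm_num, Real.rpow_neg hx.le, Real.rpow_natCast,
    ← div_eq_mul_inv, le_div_iff₀ (by positivity), mul_comm]
  exact h

/-- Order-1 decay: `‖Dv x‖ ≤ C (1+‖x‖)^{-4}` with `C ≥ 0`. (Proof device.) [folklore] -/
private theorem exists_norm_fderiv_le_of_decay {v : E3 → E3} (hd : HasRapidSpatialDecay v) :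
    ∃ C : ℝ, 0 ≤ C ∧ ∀ x, ‖fderiv ℝ v x‖ ≤ C * (1 + ‖x‖) ^ (-(4 : ℝ)) := by
  obtain ⟨C, hC⟩ := hd 1 4
  have hC0 : 0 ≤ C := le_trans (by positivity) (hC 0)
  refine ⟨C, hC0, fun x => ?_⟩
  have hx : 0 < 1 + ‖x‖ := by positivity
  have h := hC x
  rw [norm_iteratedFDeriv_one] at h
  rw [show (-(4 : ℝ)) = -((4 : ℕ) : ℝ) by norm_num, Real.rpow_neg hx.le, Real.rpow_natCast,
    ← div_eq_mul_inv, le_div_iff₀ (by positivity), mul_comm]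
  exact h

/-- `(1+‖x‖)^{-4}` is integrable on `ℝ³`. (Proof device.) [folklore] -/
private theorem integrable_weight_four :
    Integrable (fun x : E3 => (1 + ‖x‖) ^ (-(4 : ℝ))) volume := by
  have := integrable_one_add_norm (E := E3) (μ := volume) (r := 4)
    (by norm_num [finrank_euclideanSpace])
  simpa using this

/-- Domination device: a continuous `F ≥ 0` with `F ≤ C(1+‖x‖)^{-4}`, `C ≥ 0`, has `F^p ∈ L¹` for
`p ≥ 1`. (Proof device.) [folklore] -/
private theorem integrable_pow_of_le_weight {F : E3 → ℝ} (hF : Continuous F) (hF0 : ∀ x, 0 ≤ F x)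
    {C : ℝ} (hC0 : 0 ≤ C) (hle : ∀ x, F x ≤ C * (1 + ‖x‖) ^ (-(4 : ℝ))) (p : ℕ) (hp : 1 ≤ p) :
    Integrable (fun x => F x ^ p) volume := by
  refine Integrable.mono' (integrable_weight_four.const_mul (C ^ p))
    ((hF.pow p).aestronglyMeasurable) (ae_of_all _ fun x => ?_)
  rw [Real.norm_eq_abs, abs_of_nonneg (pow_nonneg (hF0 x) p)]
  have hw1 : (1 + ‖x‖) ^ (-(4 : ℝ)) ≤ 1 :=
    Real.rpow_le_one_of_one_le_of_nonpos (by linarith [norm_nonneg x]) (by norm_num)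
  have h1 : F x ≤ C := (hle x).trans (mul_le_of_le_one_right hC0 hw1)
  obtain ⟨q, rfl⟩ : ∃ q, p = q + 1 := ⟨p - 1, by omega⟩
  calc F x ^ (q + 1) = F x ^ q * F x := pow_succ _ _
    _ ≤ C ^ q * (C * (1 + ‖x‖) ^ (-(4 : ℝ))) :=
        mul_le_mul (pow_le_pow_left₀ (hF0 x) h1 q) (hle x) (hF0 x) (by positivity)
    _ = C ^ (q + 1) * (1 + ‖x‖) ^ (-(4 : ℝ)) := by ring

/-- Rapid decay ⇒ `‖v‖^p ∈ L¹(ℝ³)` for every `p ≥ 1`. (Proof device.) [folklore] -/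
private theorem integrable_norm_pow_of_decay {v : E3 → E3} (hv : Continuous v)
    (hd : HasRapidSpatialDecay v) (p : ℕ) (hp : 1 ≤ p) :
    Integrable (fun x => ‖v x‖ ^ p) volume := by
  obtain ⟨C, hC0, hC⟩ := exists_norm_le_of_decay hd
  exact integrable_pow_of_le_weight hv.norm (fun x => norm_nonneg _) hC0 hC p hp

/-- Rapid decay ⇒ `‖Dv‖^p ∈ L¹(ℝ³)` for every `p ≥ 1` (`C¹` fields). (Proof device.) [folklore] -/
private theorem integrable_norm_fderiv_pow_of_decay {v : E3 → E3} (hv : ContDiff ℝ 1 v)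
    (hd : HasRapidSpatialDecay v) (p : ℕ) (hp : 1 ≤ p) :
    Integrable (fun x => ‖fderiv ℝ v x‖ ^ p) volume := by
  obtain ⟨C, hC0, hC⟩ := exists_norm_fderiv_le_of_decay hd
  exact integrable_pow_of_le_weight (hv.continuous_fderiv one_ne_zero).norm (fun x => norm_nonneg _)
    hC0 hC p hp

/-- Rapid decay ⇒ `‖curl v‖^p ∈ L¹(ℝ³)` for every `p ≥ 1` (`‖curl v‖ ≤ κ‖Dv‖`). (Proof device.) [folklore] -/
private theorem integrable_norm_curl_pow_of_decay {v : E3 → E3} (hv : ContDiff ℝ 1 v)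
    (hd : HasRapidSpatialDecay v) (p : ℕ) (hp : 1 ≤ p) :
    Integrable (fun x => ‖curl v x‖ ^ p) volume := by
  obtain ⟨C, hC0, hC⟩ := exists_norm_fderiv_le_of_decay hd
  refine integrable_pow_of_le_weight (continuous_curl hv).norm (fun x => norm_nonneg _)
    (C := ‖curlCLM‖ * C) (by positivity) (fun x => ?_) p hp
  calc ‖curl v x‖ ≤ ‖curlCLM‖ * ‖fderiv ℝ v x‖ := norm_curl_le v x
    _ ≤ ‖curlCLM‖ * (C * (1 + ‖x‖) ^ (-(4 : ℝ))) :=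
        mul_le_mul_of_nonneg_left (hC x) (norm_nonneg curlCLM)
    _ = ‖curlCLM‖ * C * (1 + ‖x‖) ^ (-(4 : ℝ)) := by ring

/-- Cauchy–Schwarz in the form used twice: for continuous real `F, G` with `F², G² ∈ L¹`,
`∫ |F||G| ≤ √∫F² · √∫G²`. (Proof device.) [folklore] -/
private theorem integral_abs_mul_le {F G : E3 → ℝ} (hF : Continuous F) (hG : Continuous G)
    (hF2 : Integrable (fun x => F x ^ 2) volume) (hG2 : Integrable (fun x => G x ^ 2) volume) :
    ∫ x, ‖F x‖ * ‖G x‖ ≤ Real.sqrt (∫ x, F x ^ 2) * Real.sqrt (∫ x, G x ^ 2) := by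
  have hmem : ∀ {H : E3 → ℝ}, Continuous H → Integrable (fun x => H x ^ 2) volume →
      MemLp H (ENNReal.ofReal 2) volume := by
    intro H hH hH2
    rw [ENNReal.ofReal_ofNat]
    refine (memLp_two_iff_integrable_sq_norm hH.aestronglyMeasurable).2 ?_
    exact hH2.congr (ae_of_all _ fun x => by simp [Real.norm_eq_abs, sq_abs])
  have h := integral_mul_norm_le_Lp_mul_Lq Real.HolderConjugate.two_two (hmem hF hF2) (hmem hG hG2)
  have e : ∀ H : E3 → ℝ, ∫ x, ‖H x‖ ^ (2 : ℝ) = ∫ x, H x ^ 2 := fun H =>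
    integral_congr_ae (ae_of_all _ fun x => by
      show ‖H x‖ ^ (2 : ℝ) = H x ^ 2
      rw [Real.rpow_two, Real.norm_eq_abs, sq_abs])
  rw [e F, e G, ← Real.sqrt_eq_rpow, ← Real.sqrt_eq_rpow] at h
  exact h

/-- The whole-space Sobolev inequality `H¹ ⊂ L⁶` in integral form for a `C¹` rapidly decaying field:
`∫‖w‖⁶ ≤ (K √∫‖Dw‖²)⁶`, `K = SNormLESNormFDerivOfEqConst` (tree GNS, no compact support).
(Proof device.) [folklore] -/
private theorem integral_norm_pow_six_le_of_decay {w : E3 → E3} (hw : ContDiff ℝ 1 w)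
    (hd : HasRapidSpatialDecay w) :
    ∫ x, ‖w x‖ ^ 6 ≤
      ((SNormLESNormFDerivOfEqConst E3 (volume : Measure E3) 2 : ℝ) *
        Real.sqrt (∫ x, ‖fderiv ℝ w x‖ ^ 2)) ^ 6 := by
  set K₀ : NNReal := SNormLESNormFDerivOfEqConst E3 (volume : Measure E3) 2 with hK₀
  have hwc : Continuous w := hw.continuous
  have hDc : Continuous (fderiv ℝ w) := hw.continuous_fderiv one_ne_zero
  have h2 : Integrable (fun x => ‖w x‖ ^ 2) volume := integrable_norm_pow_of_decay hwc hd 2 (by norm_num)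
  have h6 : Integrable (fun x => ‖w x‖ ^ 6) volume := integrable_norm_pow_of_decay hwc hd 6 (by norm_num)
  have hD : Integrable (fun x => ‖fderiv ℝ w x‖ ^ 2) volume :=
    integrable_norm_fderiv_pow_of_decay hw hd 2 (by norm_num)
  have hm2 : MemLp w 2 volume := (memLp_two_iff_integrable_sq_norm hwc.aestronglyMeasurable).2 h2
  have hm6 : MemLp w 6 volume := by
    refine (integrable_norm_rpow_iff hwc.aestronglyMeasurable (by norm_num) (by norm_num)).1 ?_
    refine h6.congr (ae_of_all _ fun x => ?_)
    simp only [ENNReal.toReal_ofNat]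
    rw [show (6 : ℝ) = ((6 : ℕ) : ℝ) by norm_num, Real.rpow_natCast]
  have hmD : MemLp (fderiv ℝ w) 2 volume :=
    (memLp_two_iff_integrable_sq_norm hDc.aestronglyMeasurable).2 hD
  have hsob := eLpNorm_six_le_eLpNorm_fderiv_two (volume : Measure E3) (F := E3)
    finrank_euclideanSpace_fin hw hm2.eLpNorm_lt_top
  set I6 : ℝ := ∫ x, ‖w x‖ ^ 6 with hI6
  set B : ℝ := ∫ x, ‖fderiv ℝ w x‖ ^ 2 with hB
  have hI60 : 0 ≤ I6 := integral_nonneg fun x => by positivity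
  have e6 : eLpNorm w 6 volume = ENNReal.ofReal (I6 ^ ((6 : ℝ)⁻¹)) := by
    rw [MemLp.eLpNorm_eq_integral_rpow_norm (by norm_num) (by norm_num) hm6, ENNReal.toReal_ofNat]
    have hint : ∫ x, ‖w x‖ ^ (6 : ℝ) = I6 := integral_congr_ae (ae_of_all _ fun x => by
      show ‖w x‖ ^ (6 : ℝ) = ‖w x‖ ^ 6
      rw [show (6 : ℝ) = ((6 : ℕ) : ℝ) by norm_num, Real.rpow_natCast])
    simp only [hint]
  have e2 : eLpNorm (fderiv ℝ w) 2 volume = ENNReal.ofReal (Real.sqrt B) := by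
    rw [MemLp.eLpNorm_eq_integral_rpow_norm (by norm_num) (by norm_num) hmD, ENNReal.toReal_ofNat]
    have hint : ∫ x, ‖fderiv ℝ w x‖ ^ (2 : ℝ) = B := integral_congr_ae (ae_of_all _ fun x => by
      show ‖fderiv ℝ w x‖ ^ (2 : ℝ) = ‖fderiv ℝ w x‖ ^ 2
      rw [Real.rpow_two])
    rw [hint, Real.sqrt_eq_rpow, one_div]
  rw [e6, e2, ← ENNReal.ofReal_coe_nnreal, ← ENNReal.ofReal_mul (NNReal.coe_nonneg _)] at hsob
  have hle : I6 ^ ((6 : ℝ)⁻¹) ≤ (K₀ : ℝ) * Real.sqrt B :=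
    (ENNReal.ofReal_le_ofReal_iff (by positivity)).1 hsob
  have h := pow_le_pow_left₀ (Real.rpow_nonneg hI60 _) hle 6
  have hid : (I6 ^ ((6 : ℝ)⁻¹)) ^ (6 : ℕ) = I6 := by
    rw [← Real.rpow_natCast, ← Real.rpow_mul hI60]; norm_num
  rwa [hid] at h

/-- **Step 4 (Gagliardo–Nirenberg, p.3 l.5) is a THEOREM**: with `C₀ = K + 1`, `K` Mathlib's
Gagliardo–Nirenberg–Sobolev constant, `∫|w|⁴ ≤ C₀⁴ (∫|w|²)^{1/2} (∫‖∇w‖²)^{3/2}` for every smooth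
rapidly decaying `w : ℝ³ → ℝ³` (`∫|w|⁴ ≤ √∫|w|² √∫|w|⁶ ≤ K³ (∫|w|²)^{1/2} (∫‖∇w‖²)^{3/2}`).
[cite: PaiLimsuwan2026, p.3 l.5] -/
theorem step4_GN_holds : Step4_GN := by
  set K : ℝ := (SNormLESNormFDerivOfEqConst E3 (volume : Measure E3) 2 : ℝ) with hK
  have hK0 : 0 ≤ K := NNReal.coe_nonneg _
  refine ⟨K + 1, by positivity, fun w hw hd => ?_⟩
  have hwc : Continuous w := hw.continuous
  have hw1 : ContDiff ℝ 1 w := hw.of_le (by exact_mod_cast le_top)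
  set A : ℝ := ∫ x, ‖w x‖ ^ 2 with hA
  set B : ℝ := ∫ x, ‖fderiv ℝ w x‖ ^ 2 with hB
  set I6 : ℝ := ∫ x, ‖w x‖ ^ 6 with hI6
  have hA0 : 0 ≤ A := integral_nonneg fun x => by positivity
  have hB0 : 0 ≤ B := integral_nonneg fun x => by positivity
  -- Cauchy–Schwarz `∫|w|⁴ ≤ √A √I6` with `F = ‖w‖`, `G = ‖w‖³`
  have hcs := integral_abs_mul_le (F := fun x => ‖w x‖) (G := fun x => ‖w x‖ ^ 3) hwc.norm
    (hwc.norm.pow 3) (by simpa using integrable_norm_pow_of_decay hwc hd 2 (by norm_num))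
    (by simpa [← pow_mul] using integrable_norm_pow_of_decay hwc hd 6 (by norm_num))
  have e4 : ∫ x, ‖(fun x => ‖w x‖) x‖ * ‖(fun x => ‖w x‖ ^ 3) x‖ = ∫ x, ‖w x‖ ^ 4 :=
    integral_congr_ae (ae_of_all _ fun x => by
      show ‖‖w x‖‖ * ‖‖w x‖ ^ 3‖ = ‖w x‖ ^ 4
      rw [norm_norm, norm_pow, norm_norm]; ring)
  have e6 : ∫ x, (fun x => ‖w x‖ ^ 3) x ^ 2 = I6 :=
    integral_congr_ae (ae_of_all _ fun x => by show (‖w x‖ ^ 3) ^ 2 = ‖w x‖ ^ 6; ring)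
  rw [e4, e6] at hcs
  have e2 : ∫ x, (fun x => ‖w x‖) x ^ 2 = A := rfl
  rw [e2] at hcs
  -- GNS `I6 ≤ (K √B)⁶`, hence `√I6 ≤ (K √B)³`
  have h6 := integral_norm_pow_six_le_of_decay hw1 hd
  have hs6 : Real.sqrt I6 ≤ (K * Real.sqrt B) ^ 3 := by
    have := Real.sqrt_le_sqrt (h6.trans_eq (by ring : (K * Real.sqrt B) ^ 6 = ((K * Real.sqrt B) ^ 3) ^ 2))
    rwa [Real.sqrt_sq (by positivity)] at this
  -- exponents: `A^{1/2} = √A`, `B^{3/2} = (√B)³`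
  have hA12 : A ^ (1 / 2 : ℝ) = Real.sqrt A := by rw [Real.sqrt_eq_rpow]
  have hB32 : B ^ (3 / 2 : ℝ) = Real.sqrt B ^ 3 := by
    rw [Real.sqrt_eq_rpow, ← Real.rpow_natCast, ← Real.rpow_mul hB0]; norm_num
  have hK1 : K ^ 3 ≤ (K + 1) ^ 4 := by
    calc K ^ 3 ≤ (K + 1) ^ 3 := pow_le_pow_left₀ hK0 (by linarith) 3
      _ ≤ (K + 1) ^ 4 := pow_le_pow_right₀ (by linarith) (by norm_num)
  calc ∫ x, ‖w x‖ ^ 4 ≤ Real.sqrt A * Real.sqrt I6 := hcs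
    _ ≤ Real.sqrt A * (K * Real.sqrt B) ^ 3 := mul_le_mul_of_nonneg_left hs6 (Real.sqrt_nonneg _)
    _ = K ^ 3 * Real.sqrt A * Real.sqrt B ^ 3 := by ring
    _ ≤ (K + 1) ^ 4 * Real.sqrt A * Real.sqrt B ^ 3 := by gcongr
    _ = (K + 1) ^ 4 * A ^ (1 / 2 : ℝ) * B ^ (3 / 2 : ℝ) := by rw [hA12, hB32]

/-- `‖𝒯(v)(x)‖ ≤ ‖∇v(x)‖` (the adjoint is an isometry). (Proof device.) [folklore] -/
private theorem norm_strain_le (v : E3 → E3) (x : E3) : ‖strain v x‖ ≤ ‖fderiv ℝ v x‖ := by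
  unfold strain
  calc ‖(1 / 2 : ℝ) • (fderiv ℝ v x + ContinuousLinearMap.adjoint (fderiv ℝ v x))‖
      ≤ ‖(1 / 2 : ℝ)‖ * (‖fderiv ℝ v x‖ + ‖ContinuousLinearMap.adjoint (fderiv ℝ v x)‖) := by
        rw [norm_smul]; exact mul_le_mul_of_nonneg_left (norm_add_le _ _) (norm_nonneg _)
    _ = ‖fderiv ℝ v x‖ := by
        rw [LinearIsometryEquiv.norm_map, Real.norm_eq_abs, abs_of_pos (by norm_num)]; ring

/-- **Step 3 ((3.2) p.3) is a THEOREM** with `C = 1`: `|∫ ω·(𝒯(v)ω)| ≤ ‖∇v‖_{L²}‖ω‖²_{L⁴}` for smooth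
rapidly decaying fields (Cauchy–Schwarz and `‖𝒯(v)‖ ≤ ‖∇v‖` pointwise).
[cite: PaiLimsuwan2026, (3.2) p.3] -/
theorem step3_Stretch32_holds : Step3_Stretch32 := by
  refine ⟨1, one_pos, fun v hv hd => ?_⟩
  have hv1 : ContDiff ℝ 1 v := hv.of_le (by exact_mod_cast le_top)
  have hDc : Continuous (fderiv ℝ v) := hv1.continuous_fderiv one_ne_zero
  have hωc : Continuous (curl v) := continuous_curl hv1
  have hSc : Continuous (strain v) := by
    unfold strain
    exact (hDc.add ((ContinuousLinearMap.adjoint (𝕜 := ℝ) (E := E3) (F := E3)).continuous.comp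
      hDc)).const_smul (1 / 2 : ℝ)
  -- pointwise: `|⟪ω, 𝒯ω⟫| ≤ ‖𝒯(v)‖ ‖ω‖²`
  have hpt : ∀ x, ‖inner ℝ (curl v x) (strain v x (curl v x))‖ ≤
      ‖(fun x => ‖strain v x‖) x‖ * ‖(fun x => ‖curl v x‖ ^ 2) x‖ := by
    intro x
    show ‖inner ℝ (curl v x) (strain v x (curl v x))‖ ≤ ‖‖strain v x‖‖ * ‖‖curl v x‖ ^ 2‖
    rw [norm_norm, norm_pow, norm_norm]
    calc ‖inner ℝ (curl v x) (strain v x (curl v x))‖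
        ≤ ‖curl v x‖ * ‖strain v x (curl v x)‖ := norm_inner_le_norm _ _
      _ ≤ ‖curl v x‖ * (‖strain v x‖ * ‖curl v x‖) :=
          mul_le_mul_of_nonneg_left (ContinuousLinearMap.le_opNorm _ _) (norm_nonneg _)
      _ = ‖strain v x‖ * ‖curl v x‖ ^ 2 := by ring
  have hS2 : Integrable (fun x => ‖strain v x‖ ^ 2) volume := by
    refine (integrable_norm_fderiv_pow_of_decay hv1 hd 2 (by norm_num)).mono'
      ((hSc.norm.pow 2).aestronglyMeasurable) (ae_of_all _ fun x => ?_)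
    rw [Real.norm_eq_abs, abs_of_nonneg (by positivity)]
    exact pow_le_pow_left₀ (norm_nonneg _) (norm_strain_le v x) 2
  have hω4 : Integrable (fun x => (‖curl v x‖ ^ 2) ^ 2) volume := by
    simpa [← pow_mul] using integrable_norm_curl_pow_of_decay hv1 hd 4 (by norm_num)
  have hcs := integral_abs_mul_le (F := fun x => ‖strain v x‖) (G := fun x => ‖curl v x‖ ^ 2)
    hSc.norm (hωc.norm.pow 2) hS2 hω4
  -- the integrand is integrable (dominated by `‖𝒯‖‖ω‖²`, product of two `L²` functions)
  have hint : Integrable (fun x => inner ℝ (curl v x) (strain v x (curl v x))) volume := by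
    have hprod : Integrable (fun x => ‖(fun x => ‖strain v x‖) x‖ * ‖(fun x => ‖curl v x‖ ^ 2) x‖)
        volume := by
      have hmF : MemLp (fun x => ‖strain v x‖) 2 volume :=
        (memLp_two_iff_integrable_sq_norm hSc.norm.aestronglyMeasurable).2
          (hS2.congr (ae_of_all _ fun x => by simp))
      have hmG : MemLp (fun x => ‖curl v x‖ ^ 2) 2 volume :=
        (memLp_two_iff_integrable_sq_norm (hωc.norm.pow 2).aestronglyMeasurable).2
          (hω4.congr (ae_of_all _ fun x => by simp))
      exact hmF.norm.integrable_mul hmG.norm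
    refine hprod.mono' ?_ (ae_of_all _ hpt)
    exact (Continuous.inner hωc (hSc.clm_apply hωc)).aestronglyMeasurable
  have e1 : ∫ x, (fun x => ‖strain v x‖) x ^ 2 = ∫ x, ‖strain v x‖ ^ 2 := rfl
  have e2 : ∫ x, (fun x => ‖curl v x‖ ^ 2) x ^ 2 = ∫ x, ‖curl v x‖ ^ 4 :=
    integral_congr_ae (ae_of_all _ fun x => by show (‖curl v x‖ ^ 2) ^ 2 = ‖curl v x‖ ^ 4; ring)
  rw [e1, e2] at hcs
  have hSD : Real.sqrt (∫ x, ‖strain v x‖ ^ 2) ≤ Real.sqrt (∫ x, ‖fderiv ℝ v x‖ ^ 2) :=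
    Real.sqrt_le_sqrt (integral_mono hS2 (integrable_norm_fderiv_pow_of_decay hv1 hd 2 (by norm_num))
      fun x => pow_le_pow_left₀ (norm_nonneg _) (norm_strain_le v x) 2)
  unfold stretchF
  calc |∫ x, inner ℝ (curl v x) (strain v x (curl v x))|
      = ‖∫ x, inner ℝ (curl v x) (strain v x (curl v x))‖ := (Real.norm_eq_abs _).symm
    _ ≤ ∫ x, ‖inner ℝ (curl v x) (strain v x (curl v x))‖ := norm_integral_le_integral_norm _
    _ ≤ ∫ x, ‖(fun x => ‖strain v x‖) x‖ * ‖(fun x => ‖curl v x‖ ^ 2) x‖ :=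
        integral_mono_of_nonneg (ae_of_all _ fun x => norm_nonneg _)
          (by
            have hmF : MemLp (fun x => ‖strain v x‖) 2 volume :=
              (memLp_two_iff_integrable_sq_norm hSc.norm.aestronglyMeasurable).2
                (hS2.congr (ae_of_all _ fun x => by simp))
            have hmG : MemLp (fun x => ‖curl v x‖ ^ 2) 2 volume :=
              (memLp_two_iff_integrable_sq_norm (hωc.norm.pow 2).aestronglyMeasurable).2
                (hω4.congr (ae_of_all _ fun x => by simp))
            exact hmF.norm.integrable_mul hmG.norm)
          (ae_of_all _ hpt)
    _ ≤ Real.sqrt (∫ x, ‖strain v x‖ ^ 2) * Real.sqrt (∫ x, ‖curl v x‖ ^ 4) := hcs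
    _ ≤ 1 * Real.sqrt (∫ x, ‖fderiv ℝ v x‖ ^ 2) * Real.sqrt (∫ x, ‖curl v x‖ ^ 4) := by
        rw [one_mul]; exact mul_le_mul_of_nonneg_right hSD (Real.sqrt_nonneg _)

end Certificates

/-! ## Rev 2 (additive; chair RULED C136 KEYING 2026-08-27T06:06:01Z, ref-4 g4 PRE-READ (i)/(ii),
refuter-4 g3 06:01:03Z): the print-grain face of (3.4) put ON the composition path, and the
Hilbert–Schmidt twin of (3.1)

(ii) `Step8_GradsqCont` (continuity of `t ↦ ‖∇u(t)‖²_{L²}` on `[0,T)`, true by literature, typed) and the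
PROVED bridge `step7_of_abs : Step1_Energy24 → Step8_GradsqCont → Step7A_L1toL2_abs → Step7_ExpFinite24`
((2.4) gives `∫₀ᵗ‖∇u‖² ≤ ‖u(0)‖²/(2ν)` uniformly on `[0,T)`; the real-variable face then bounds
`∫₀ᵗ‖∇u‖⁴`), with `clay_of_steps_abs` / `claim_of_steps_abs` — so a kernel `¬ Step7A_L1toL2_abs` is
type-exact ON PATH (§1g). (i) `vortgradsqHS` / `Step2H_Enstrophy31`: (3.1) is an IDENTITY only with the
Hilbert–Schmidt norm `Σⱼ|∂ⱼω|²` of `∇ω`; the rev-1 `Step2_Enstrophy31` (operator norm) is inequality-grade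
(`‖∇ω‖_op ≤ ‖∇ω‖_HS`) and is kept unchanged, off path. Nothing asserted; no rev-1 decl touched. -/

section Rev2

/-- `‖∇ω(t)‖²_{ℒ²}` with the HILBERT–SCHMIDT (Frobenius) norm `Σⱼ |∂ⱼω(x)|²`, `∂ⱼ = D(·)(x) eⱼ` — the norm in
which (3.1) is an identity. [cite: PaiLimsuwan2026, (3.1) p.2] -/
noncomputable def vortgradsqHS (u : ℝ → E3 → E3) (t : ℝ) : ℝ :=
  ∫ x, ∑ j : Fin 3, ‖fderiv ℝ (curl (u t)) x (EuclideanSpace.single j 1)‖ ^ 2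

/-- **Step 2, Hilbert–Schmidt twin — (3.1) p.2 as an IDENTITY**: `d/dt 𝒬 + ν Σⱼ‖∂ⱼω‖²_{ℒ²} = ∫ ω·(𝒯(u)ω)`
along the solutions typed here (`f = 0`), interior times. True by literature; off the composition path
(ref-4 g4 PRE-READ (i): the operator-norm rendering `Step2_Enstrophy31` is inequality-grade only).
[cite: PaiLimsuwan2026, (3.1) p.2] -/
def Step2H_Enstrophy31 : Prop :=
  ∀ (ν T : ℝ) (u₀ : E3 → E3) (u : ℝ → E3 → E3) (p : ℝ → E3 → ℝ), SlabSol ν T u₀ u p →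
    ∀ t ∈ Ioo 0 T, HasDerivAt (enstrophy u) (stretch u t - ν * vortgradsqHS u t) t

/-- **Step 8 (implicit, p.3 l.8–9)** — what «applying Grönwall» to a solution presupposes of the
coefficient: `t ↦ ‖∇u(t)‖²_{ℒ²}` is continuous on `[0,T)` for the finite-energy classical solutions typed
here. True by literature (Tao 2013, energy class of finite-energy classical solutions from Schwartz
data); typed so that the print-grain face `Step7A_L1toL2_abs` sits on the composition path.
[cite: PaiLimsuwan2026, (3.4) p.3 l.8–9] -/
def Step8_GradsqCont : Prop :=
  ∀ (ν T : ℝ) (u₀ : E3 → E3) (u : ℝ → E3 → E3) (p : ℝ → E3 → ℝ), SlabSol ν T u₀ u p →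
    ContinuousOn (gradsq u) (Ico 0 T)

/-- **BRIDGE (PROVED): the print-grain inference gives Step 7.** From (2.4) (Step 1) the coefficient
`g = ‖∇u‖²_{ℒ²}` has `∫₀ᵗ g ≤ ‖u(0)‖²_{ℒ²}/(2ν)` uniformly on `[0,T)`; it is continuous (Step 8) and
non-negative; the real-variable face `Step7A_L1toL2_abs` then bounds `∫₀ᵗ g² = ∫₀ᵗ‖∇u‖⁴_{ℒ²}` uniformly —
which is Step 7. So `¬ Step7A_L1toL2_abs` is a type-exact kill ON the composition path.
[cite: PaiLimsuwan2026, (3.4) with (2.4), p.3 l.8–10] -/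
theorem step7_of_abs (h1 : Step1_Energy24) (h8 : Step8_GradsqCont) (hA : Step7A_L1toL2_abs) :
    Step7_ExpFinite24 := by
  intro ν T u₀ u p hS
  by_cases hT : 0 < T
  · have hν : 0 < ν := hS.visc
    have hE : ∃ E : ℝ, ∀ t ∈ Ico 0 T, ∫ s in (0 : ℝ)..t, gradsq u s ≤ E := by
      refine ⟨energy u 0 / (2 * ν), fun t ht => ?_⟩
      have h := h1 ν T u₀ u p hS t ht
      have he : 0 ≤ energy u t := integral_nonneg fun x => by positivity
      rw [le_div_iff₀ (by positivity)]
      nlinarith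
    exact hA T hT (gradsq u) (h8 ν T u₀ u p hS)
      (fun s _ => integral_nonneg fun x => by positivity) hE
  · exact ⟨0, fun t ht => absurd (ht.1.trans_lt ht.2) hT⟩

/-- **CLAY LINK through the print-grain face (PROVED).** [cite: PaiLimsuwan2026, (2.4)–§4 p.2–3] -/
theorem clay_of_steps_abs (h1 : Step1_Energy24) (h8 : Step8_GradsqCont) (hA : Step7A_L1toL2_abs)
    (h6 : Step6_Gronwall34) : clayR3.Regularity :=
  clay_of_steps h6 (step7_of_abs h1 h8 hA)

/-- **COMPOSITION through the print-grain face (PROVED)**: (2.4) ∧ continuity ∧ «L¹ ⇒ L² for the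
coefficient» ∧ Grönwall (3.4) ∧ decay ⇒ the claim. [cite: PaiLimsuwan2026, §4 p.3] -/
theorem claim_of_steps_abs (h1 : Step1_Energy24) (h8 : Step8_GradsqCont) (hA : Step7A_L1toL2_abs)
    (h6 : Step6_Gronwall34) (h9 : Step9_Decay) : ClaimedTheorem :=
  claim_of_steps h6 (step7_of_abs h1 h8 hA) h9

/-- Hygiene record for (i): the operator norm is dominated by the Hilbert–Schmidt norm pointwise,
`‖L‖² ≤ Σⱼ ‖L eⱼ‖²` for `L : ℝ³ →L ℝ³` — so `vortgradsq ≤ vortgradsqHS` integrand-wise and the rev-1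
`Step2_Enstrophy31` is the inequality-grade reading. (Proof device, private: kernel record of the
hygiene remark only.) [folklore] -/
private theorem opNorm_sq_le_sum_sq (L : E3 →L[ℝ] E3) :
    ‖L‖ ^ 2 ≤ ∑ j : Fin 3, ‖L (EuclideanSpace.single j 1)‖ ^ 2 := by
  have hS0 : 0 ≤ ∑ j : Fin 3, ‖L (EuclideanSpace.single j 1)‖ ^ 2 :=
    Finset.sum_nonneg fun j _ => by positivity
  have hop : ‖L‖ ≤ Real.sqrt (∑ j : Fin 3, ‖L (EuclideanSpace.single j 1)‖ ^ 2) := by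
    refine ContinuousLinearMap.opNorm_le_bound _ (Real.sqrt_nonneg _) fun v => ?_
    -- `L v = Σ vⱼ L eⱼ`, then Cauchy–Schwarz in `Fin 3`
    have hv : v = ∑ j : Fin 3, v j • EuclideanSpace.single j (1 : ℝ) := by
      conv_lhs => rw [← (EuclideanSpace.basisFun (Fin 3) ℝ).sum_repr v]
      simp [EuclideanSpace.basisFun_apply, EuclideanSpace.basisFun_repr]
    have hLv : L v = ∑ j : Fin 3, v j • L (EuclideanSpace.single j 1) := by
      conv_lhs => rw [hv]
      simp [map_sum, map_smul]
    calc ‖L v‖ = ‖∑ j : Fin 3, v j • L (EuclideanSpace.single j 1)‖ := by rw [hLv]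
      _ ≤ ∑ j : Fin 3, ‖v j • L (EuclideanSpace.single j 1)‖ := norm_sum_le _ _
      _ = ∑ j : Fin 3, |v j| * ‖L (EuclideanSpace.single j 1)‖ := by
          simp [norm_smul, Real.norm_eq_abs]
      _ ≤ Real.sqrt (∑ j : Fin 3, |v j| ^ 2) *
            Real.sqrt (∑ j : Fin 3, ‖L (EuclideanSpace.single j 1)‖ ^ 2) :=
          Real.sum_mul_le_sqrt_mul_sqrt _ _ _
      _ = Real.sqrt (∑ j : Fin 3, ‖L (EuclideanSpace.single j 1)‖ ^ 2) * ‖v‖ := by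
          rw [mul_comm, EuclideanSpace.norm_eq]
          simp [Real.norm_eq_abs, sq_abs]
  calc ‖L‖ ^ 2 ≤ (Real.sqrt (∑ j : Fin 3, ‖L (EuclideanSpace.single j 1)‖ ^ 2)) ^ 2 :=
        pow_le_pow_left₀ (norm_nonneg _) hop 2
    _ = ∑ j : Fin 3, ‖L (EuclideanSpace.single j 1)‖ ^ 2 := Real.sq_sqrt hS0

end Rev2

/-! ## Rev 3 (append-only, D-0026 debt): kernel certificates for Step 1 ((2.4) p.2) and Step 8 (p.3 l.8–9)

On the rev-2 composition path `step7_of_abs : Step1_Energy24 → Step8_GradsqCont → Step7A_L1toL2_abs →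
Step7_ExpFinite24` the two TRUE premises are discharged here, so that only the adjudicated locator
`Step7A_L1toL2_abs` (refuted Summits-side, `…Theorems.PaiLimsuwan2026.not_Step7A_L1toL2_abs`, p506901)
is left on the path. FIRST KERNEL PROOFS (Summits side, not importable from `Literature/`):
`Summit.NavierStokesRegularity.NavierStokesRegularity.Theorems.PaiLimsuwan2026.step1_Energy24_holds` and
`…step8_GradsqCont_holds` (`Theorems/SoloSalvagePaiLimsuwan2026.lean`, seat ns-claims-salvage-p4 g3,
p507559); these in-file copies (same proofs, helpers private) exist only so that the Literature-side facts
carry their `_holds` (D-0026 census). Nothing in the verdict / locator / class / statements changes.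

* Step 1: Leray's energy EQUALITY for finite-energy classical solutions
  (`IsClassicalNSSolutionOn.energyEq_finiteEnergy`, Leray 1934 (3.4) / Tao 2013 Lemma 8.1, PROVED in the
  tree) plus `‖∇u‖_{op} ≤ |∇u|_F` (the skeleton's `gradsq` uses the operator norm; junk values of the
  Bochner / interval integrals are `0`, on the safe side of the inequality).
* Step 8: below every `S < T` a `SlabSol` coincides with a Tao-class solution (finite energy ⇒ Leray–Hopf
  `isLerayHopfOn_of_finiteEnergy` ⇒ Kato `isKatoSolutionOn_of_classical` ⇒ Tao-class below the lifespan
  `exists_isTaoSolutionOn_of_isKatoSolutionOn` ⇒ equal by `IsClassicalNSSolutionOn.eq_of_hasBoundedSobolevNormsOn`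
  with `tao2011_hasBoundedSobolevNormsOn_holds`), and the gradient of a Tao-class solution is continuous
  into `L²` (enstrophy balance `IsSmoothSpaceTimeOn.enstrophy_balance` of the difference field
  `u(·) − u(t₀)`; the operator norm is dominated by the Frobenius norm), whence
  `ContinuousInLpOn.continuousOn_integral_norm_sq`.

## References (rev 3)
* J. Leray, Acta Math. 63 (1934), §17 (3.4). [`Leray1934`]
* T. Tao, Anal. PDE 6 (2013) = arXiv:1108.1165, Lemma 8.1, Thm. 5.4 (iv), Cor. 11.1. [`Tao2011`] -/

section Rev3

open Function Topology
open scoped NNReal InnerProductSpace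

/-! ### Step 1 — the energy inequality (2.4) -/

/-- Slice bound: `ofReal (∫‖∇v‖²_{op}) ≤ ∫⁻ |∇v|²_F` (junk value `0` on the left if not integrable).
(Proof device.) [folklore] -/
private theorem c136_ofReal_integral_norm_fderiv_sq_le (v : E3 → E3) :
    ENNReal.ofReal (∫ x, ‖fderiv ℝ v x‖ ^ 2) ≤
      ∫⁻ x, ENNReal.ofReal (frobeniusNormSq (fderiv ℝ v x)) := by
  by_cases hi : Integrable (fun x => ‖fderiv ℝ v x‖ ^ 2) volume
  · rw [ofReal_integral_eq_lintegral_ofReal hi (ae_of_all _ fun x => by positivity)]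
    exact lintegral_mono fun x => ENNReal.ofReal_le_ofReal (sq_opNorm_le_frobeniusNormSq _)
  · rw [integral_undef hi, ENNReal.ofReal_zero]; exact bot_le

/-- **Step 1 ((2.4) p.2) is a THEOREM**: for every finite-energy classical solution of the unforced
system on `[0,T) × ℝ³` from a Clay datum and every `t ∈ [0,T)`,
`‖u(t)‖²_{L²} + 2ν ∫₀ᵗ ‖∇u(s)‖²_{L²} ds ≤ ‖u(0)‖²_{L²}` (operator norm of `∇u`; Leray's energy equality
for finite-energy classical solutions, `IsClassicalNSSolutionOn.energyEq_finiteEnergy`, and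
`‖∇u‖_{op} ≤ |∇u|_F`). Literature-side twin of the Summits-side
`Summit.NavierStokesRegularity.NavierStokesRegularity.Theorems.PaiLimsuwan2026.step1_Energy24_holds`
(p507559). [cite: PaiLimsuwan2026, (2.4) p.2] [cite: Leray1934, §17 (3.4) p. 220] [cite: Tao2011, Lemma 8.1] -/
theorem step1_Energy24_holds : Step1_Energy24 := by
  intro ν T u₀ u p hS t ht
  have hν : 0 < ν := hS.visc
  rcases ht.1.eq_or_lt with h0 | htpos
  · subst h0
    simp [intervalIntegral.integral_same]
  have hsub : Icc (0 : ℝ) t ⊆ Ico 0 T := fun s hs => ⟨hs.1, hs.2.trans_lt ht.2⟩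
  have hcl : IsClassicalNSSolutionOn (Icc 0 t) ν 0 u p := hS.solves.mono hsub (uniqueDiffOn_Icc htpos)
  have hfe : ∃ A : ℝ≥0∞, A < ⊤ ∧ ∀ s ∈ Icc (0 : ℝ) t, ∫⁻ x, ‖u s x‖ₑ ^ 2 ≤ A := by
    obtain ⟨A, hA, hAle⟩ := hS.finiteEnergy
    exact ⟨A, hA, fun s hs => hAle s (hsub hs)⟩
  have hE := hcl.energyEq_finiteEnergy hν htpos hfe le_rfl ht.1 le_rfl
  obtain ⟨A, -, -, -, hgrad⟩ := energyClass_of_finiteEnergy hcl hν htpos hfe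
  set D : ℝ≥0∞ := ∫⁻ τ in Ioo 0 t, ∫⁻ x, ENNReal.ofReal (frobeniusNormSq (fderiv ℝ (u τ) x)) with hD
  -- the printed dissipation (operator norm, junk-safe) is dominated by the lower-integral one
  have hkey : ∫ τ in (0 : ℝ)..t, gradsq u τ ≤ D.toReal := by
    by_cases hint : IntervalIntegrable (gradsq u) volume 0 t
    · rw [intervalIntegral.integral_of_le ht.1]
      have hnn : 0 ≤ᵐ[volume.restrict (Ioc 0 t)] fun τ => gradsq u τ :=
        ae_of_all _ fun τ => integral_nonneg fun x => by positivity
      rw [integral_eq_lintegral_of_nonneg_ae hnn hint.1.aestronglyMeasurable]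
      refine ENNReal.toReal_mono hgrad.ne ?_
      have hIoc : (volume.restrict (Ioc (0 : ℝ) t)) = volume.restrict (Ioo 0 t) :=
        (Measure.restrict_congr_set Ioo_ae_eq_Ioc).symm
      rw [hIoc, hD]
      exact lintegral_mono fun τ => c136_ofReal_integral_norm_fderiv_sq_le (u τ)
    · rw [intervalIntegral.integral_undef hint]; exact ENNReal.toReal_nonneg
  have he : ∀ s, energy u s = 2 * VectorCalculus.kineticEnergy (u s) := fun s => by
    simp only [energy, VectorCalculus.kineticEnergy]; ring
  rw [he, he]
  have h2 : 2 * ν * ∫ τ in (0 : ℝ)..t, gradsq u τ ≤ 2 * ν * D.toReal :=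
    mul_le_mul_of_nonneg_left hkey (by positivity)
  linarith

/-! ### Finite-energy classical solutions on `[0,T)` are Tao-class below `T` -/

/-- **A `SlabSol` coincides with a Tao-class solution on every `[0,S]`, `S < T`.** Finite energy ⇒
Leray–Hopf on `[0,S']` (`isLerayHopfOn_of_finiteEnergy`, `S < S' < T`) ⇒ Kato on `[0,S')`
(`isKatoSolutionOn_of_classical`) ⇒ a Tao-class solution from `u₀` on `[0,S]`
(`exists_isTaoSolutionOn_of_isKatoSolutionOn`), which equals `u` there by uniqueness in
`L^∞_t H^k` (`IsClassicalNSSolutionOn.eq_of_hasBoundedSobolevNormsOn`, the bounds of `u` by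
`tao2011_hasBoundedSobolevNormsOn_holds`). (Proof device.) [cite: Tao2011, Cor. 11.1 with Lemma 8.1] -/
private theorem exists_isTaoSolutionOn_eqOn_of_slabSol {ν T : ℝ} {u₀ : E3 → E3} {u : ℝ → E3 → E3}
    {p : ℝ → E3 → ℝ} (hS : SlabSol ν T u₀ u p) {S : ℝ} (hS0 : 0 < S) (hST : S < T) :
    ∃ (U : ℝ → E3 → E3) (P : ℝ → E3 → ℝ), IsTaoSolutionOn S ν u₀ U P ∧ ∀ t ∈ Icc 0 S, u t = U t := by
  have hν : 0 < ν := hS.visc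
  set S' : ℝ := (S + T) / 2 with hS'
  have h1 : S < S' := by rw [hS']; linarith
  have h2 : S' < T := by rw [hS']; linarith
  have hS'0 : 0 < S' := hS0.trans h1
  have hsub' : Icc (0 : ℝ) S' ⊆ Ico 0 T := fun s hs => ⟨hs.1, hs.2.trans_lt h2⟩
  have hcl' : IsClassicalNSSolutionOn (Icc 0 S') ν 0 u p := hS.solves.mono hsub' (uniqueDiffOn_Icc hS'0)
  obtain ⟨A, hA, hAle⟩ := hS.finiteEnergy
  have hfe' : ∃ A : ℝ≥0∞, A < ⊤ ∧ ∀ s ∈ Icc (0 : ℝ) S', ∫⁻ x, ‖u s x‖ₑ ^ 2 ≤ A :=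
    ⟨A, hA, fun s hs => hAle s (hsub' hs)⟩
  have hLH := (isLerayHopfOn_of_finiteEnergy hcl' hν hS'0 hfe').1
  have hclo : IsClassicalNSSolutionOn (Ico 0 S') ν 0 u p :=
    hcl'.mono Ico_subset_Icc_self (uniqueDiffOn_Ico 0 S')
  have hdec0 : HasRapidSpatialDecay (u 0) := by rw [hS.initial]; exact hS.data_decay
  have hK : IsKatoSolutionOn S' ν (u 0) u := isKatoSolutionOn_of_classical hν hS'0 hclo hLH hdec0
  rw [hS.initial] at hK
  obtain ⟨U, P, hUP⟩ :=
    exists_isTaoSolutionOn_of_isKatoSolutionOn hν hS.data_smooth hS.data_divFree hS.data_decay hK hS0 h1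
  refine ⟨U, P, hUP, fun t ht => ?_⟩
  have hsub : Icc (0 : ℝ) S ⊆ Ico 0 T := fun s hs => ⟨hs.1, hs.2.trans_lt hST⟩
  have hcl : IsClassicalNSSolutionOn (Icc 0 S) ν 0 u p := hS.solves.mono hsub (uniqueDiffOn_Icc hS0)
  have hE : ∃ C : ℝ≥0, ∀ s ∈ Icc (0 : ℝ) S, ∫⁻ x, ‖u s x‖ₑ ^ 2 ≤ C :=
    ⟨A.toNNReal, fun s hs => (hAle s (hsub hs)).trans (ENNReal.coe_toNNReal hA.ne).symm.le⟩
  have hBu : HasBoundedSobolevNormsOn (Icc 0 S) u := tao2011_hasBoundedSobolevNormsOn_holds hν hS0 hcl hE hdec0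
  exact hcl.eq_of_hasBoundedSobolevNormsOn hUP.classical hν.le hS0 hBu hUP.sobolev
    (by rw [hS.initial, hUP.initial]) ht

/-! ### The gradient of a Tao-class solution is continuous into `L²` -/

/-- `‖a − b‖ₑ² ≤ 2(‖a‖ₑ² + ‖b‖ₑ²)` in any seminormed group. (Proof device.) [folklore] -/
private theorem c136_enorm_sub_sq_le {G : Type*} [SeminormedAddCommGroup G] (a b : G) :
    ‖a - b‖ₑ ^ 2 ≤ 2 * (‖a‖ₑ ^ 2 + ‖b‖ₑ ^ 2) := by
  have h : (‖a - b‖₊ : ℝ≥0) ^ 2 ≤ 2 * (‖a‖₊ ^ 2 + ‖b‖₊ ^ 2) := by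
    have h1 : ‖a - b‖ ≤ ‖a‖ + ‖b‖ := norm_sub_le a b
    have h2 : ‖a - b‖ * ‖a - b‖ ≤ (‖a‖ + ‖b‖) * (‖a‖ + ‖b‖) :=
      mul_le_mul h1 h1 (norm_nonneg _) (add_nonneg (norm_nonneg _) (norm_nonneg _))
    rw [← NNReal.coe_le_coe]
    push_cast
    nlinarith [h2, sq_nonneg (‖a‖ - ‖b‖)]
  have e : ∀ c : G, ‖c‖ₑ ^ 2 = ((‖c‖₊ ^ 2 : ℝ≥0) : ℝ≥0∞) := fun c => by
    rw [enorm_eq_nnnorm, ENNReal.coe_pow]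
  rw [e, e, e]
  calc ((‖a - b‖₊ ^ 2 : ℝ≥0) : ℝ≥0∞) ≤ ((2 * (‖a‖₊ ^ 2 + ‖b‖₊ ^ 2) : ℝ≥0) : ℝ≥0∞) :=
        ENNReal.coe_le_coe.2 h
    _ = 2 * ((‖a‖₊ ^ 2 : ℝ≥0) + ((‖b‖₊ ^ 2 : ℝ≥0) : ℝ≥0∞)) := by push_cast; ring

/-- **The gradient of a Tao-class solution is continuous into `L²(ℝ³)`** on `[0,S]`: `∇U(t) ∈ L²` for
every `t` (`integrable_norm_fderiv_sq`), and `‖∇U(t) − ∇U(t₀)‖_{L²} → 0` as `t → t₀` because the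
Frobenius energy `∫|∇(U(t) − U(t₀))|²_F` of the difference field is continuous in `t`
(`IsSmoothSpaceTimeOn.enstrophy_balance`, from the `L^∞_t H¹` bounds of `U` and `∂ₜU`) and vanishes at
`t = t₀`, while the operator norm is dominated by the Frobenius norm. (Proof device.)
[cite: Tao2011, Thm. 5.4 (iv)] -/
private theorem continuousInLpOn_fderiv_of_isTaoSolutionOn {S ν : ℝ} {u₀ : E3 → E3} {U : ℝ → E3 → E3}
    {P : ℝ → E3 → ℝ} (h : IsTaoSolutionOn S ν u₀ U P) (hS : 0 < S) :
    ContinuousInLpOn (Icc 0 S) 2 (fun t x => fderiv ℝ (U t) x) := by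
  have hsm : IsSmoothSpaceTimeOn (Icc 0 S) U := h.classical.smooth_velocity
  obtain ⟨C₁, hC₁⟩ := h.sobolev 1
  obtain ⟨D₁, hD₁⟩ := h.sobolev_dt 1
  have hUc : ∀ t ∈ Icc 0 S, ContDiff ℝ ∞ (U t) := fun t ht => h.classical.contDiff_velocity ht
  refine ⟨fun t ht => ?_, fun t₀ ht₀ => ?_⟩
  · exact (memLp_two_iff_integrable_sq_norm
      (((hUc t ht).continuous_fderiv (by simp)).aestronglyMeasurable)).2 (h.integrable_norm_fderiv_sq ht)
  have hU0 : ContDiff ℝ ∞ (U t₀) := hUc t₀ ht₀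
  -- the difference field `w(τ) = U(τ) − U(t₀)`
  set w : ℝ → E3 → E3 := U - fun _ => U t₀ with hw_def
  have hwτ : ∀ τ, w τ = U τ - U t₀ := fun τ => rfl
  have hw : IsSmoothSpaceTimeOn (Icc 0 S) w := hsm.sub (isSmoothSpaceTimeOn_const_time hU0 _)
  have hwc : ∀ τ ∈ Icc 0 S, ContDiff ℝ ∞ (w τ) := fun τ hτ => by rw [hwτ]; exact (hUc τ hτ).sub hU0
  -- `H¹` bounds for `w` and `∂ₜw`
  have hmeas : ∀ f : E3 → E3, ContDiff ℝ ∞ f →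
      Measurable fun x => ‖iteratedFDeriv ℝ 1 f x‖ₑ ^ 2 := fun f hf =>
    ((hf.continuous_iteratedFDeriv (m := 1) (by exact_mod_cast le_top)).enorm).measurable.pow_const _
  have hC : ∀ τ ∈ Icc 0 S, ∫⁻ x, ‖iteratedFDeriv ℝ 1 (w τ) x‖ₑ ^ 2 ≤ (2 * (C₁ + C₁) : ℝ≥0) := by
    intro τ hτ
    have e : ∀ x, iteratedFDeriv ℝ 1 (w τ) x = iteratedFDeriv ℝ 1 (U τ) x - iteratedFDeriv ℝ 1 (U t₀) x := by
      intro x; rw [hwτ]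
      exact iteratedFDeriv_sub_apply ((hUc τ hτ).of_le (mod_cast le_top)).contDiffAt
        (hU0.of_le (mod_cast le_top)).contDiffAt
    calc ∫⁻ x, ‖iteratedFDeriv ℝ 1 (w τ) x‖ₑ ^ 2
        ≤ ∫⁻ x, 2 * (‖iteratedFDeriv ℝ 1 (U τ) x‖ₑ ^ 2 + ‖iteratedFDeriv ℝ 1 (U t₀) x‖ₑ ^ 2) :=
          lintegral_mono fun x => by rw [e x]; exact c136_enorm_sub_sq_le _ _
      _ = 2 * ((∫⁻ x, ‖iteratedFDeriv ℝ 1 (U τ) x‖ₑ ^ 2) + ∫⁻ x, ‖iteratedFDeriv ℝ 1 (U t₀) x‖ₑ ^ 2) := by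
          rw [lintegral_const_mul' _ _ (by norm_num), lintegral_add_left (hmeas _ (hUc τ hτ))]
      _ ≤ (2 * (C₁ + C₁) : ℝ≥0) := by
          push_cast
          gcongr
          · exact hC₁ τ hτ
          · exact hC₁ t₀ ht₀
  have hD : ∀ τ ∈ Icc 0 S,
      ∫⁻ x, ‖iteratedFDeriv ℝ 1 (timeDerivWithin (Icc 0 S) w τ) x‖ₑ ^ 2 ≤ D₁ := by
    intro τ hτ
    have e : timeDerivWithin (Icc 0 S) w τ = timeDerivWithin (Icc 0 S) U τ := by
      funext x
      rw [hw_def, hsm.timeDerivWithin_sub (isSmoothSpaceTimeOn_const_time hU0 _) hτ x]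
      simp [timeDerivWithin_apply]
    rw [e]; exact hD₁ τ hτ
  obtain ⟨-, hFc, -⟩ := hw.enstrophy_balance hS hC hD
  -- `F(t₀) = 0`
  have hF0 : (∫ x, frobeniusNormSq (fderiv ℝ (w t₀) x)) = 0 := by
    have h0 : w t₀ = fun _ => 0 := by funext x; simp [hwτ]
    simp [h0, frobeniusNormSq_zero]
  -- pointwise: `∇w(τ) = ∇U(τ) − ∇U(t₀)`
  have hDw : ∀ τ ∈ Icc 0 S, ∀ x, fderiv ℝ (w τ) x = fderiv ℝ (U τ) x - fderiv ℝ (U t₀) x := by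
    intro τ hτ x
    rw [hwτ]
    exact fderiv_sub (((hUc τ hτ).differentiable (by simp)) x) ((hU0.differentiable (by simp)) x)
  -- the `L²` distance of the gradients is dominated by `√F`
  have hle : ∀ τ ∈ Icc 0 S,
      eLpNorm ((fun x => fderiv ℝ (U τ) x) - fun x => fderiv ℝ (U t₀) x) 2 volume ≤
        (ENNReal.ofReal (∫ x, frobeniusNormSq (fderiv ℝ (w τ) x))) ^ (1 / 2 : ℝ) := by
    intro τ hτ
    refine eLpNorm_two_le_rpow_of_lintegral_sq_le ?_
    have hi1 := h.integrable_norm_fderiv_sq hτ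
    have hi0 := h.integrable_norm_fderiv_sq ht₀
    have hint : Integrable (fun x => frobeniusNormSq (fderiv ℝ (w τ) x)) volume := by
      refine (((hi1.add hi0).const_mul 6).mono'
        (LerayHopfProofs.continuous_frobeniusNormSq.comp
          ((hwc τ hτ).continuous_fderiv (by simp))).aestronglyMeasurable
        (ae_of_all _ fun x => ?_))
      rw [Real.norm_eq_abs, abs_of_nonneg (frobeniusNormSq_nonneg _), hDw τ hτ x, Pi.add_apply]
      have h3 := frobeniusNormSq_le_three_mul (fderiv ℝ (U τ) x - fderiv ℝ (U t₀) x)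
      have hn := norm_sub_le (fderiv ℝ (U τ) x) (fderiv ℝ (U t₀) x)
      have hn0 : 0 ≤ ‖fderiv ℝ (U τ) x - fderiv ℝ (U t₀) x‖ := norm_nonneg _
      nlinarith [h3, hn, hn0, sq_nonneg (‖fderiv ℝ (U τ) x‖ - ‖fderiv ℝ (U t₀) x‖),
        norm_nonneg (fderiv ℝ (U τ) x), norm_nonneg (fderiv ℝ (U t₀) x)]
    rw [ofReal_integral_eq_lintegral_ofReal hint (ae_of_all _ fun x => frobeniusNormSq_nonneg _)]
    refine lintegral_mono fun x => ?_
    rw [Pi.sub_apply, ← hDw τ hτ x, ← ofReal_norm, ← ENNReal.ofReal_pow (norm_nonneg _)]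
    exact ENNReal.ofReal_le_ofReal (sq_opNorm_le_frobeniusNormSq _)
  -- `√F(τ) → 0` as `τ → t₀` within `[0,S]`
  have hT0 : Tendsto (fun τ => (ENNReal.ofReal (∫ x, frobeniusNormSq (fderiv ℝ (w τ) x))) ^ (1 / 2 : ℝ))
      (𝓝[Icc 0 S] t₀) (𝓝 0) := by
    have h1 : Tendsto (fun τ => ∫ x, frobeniusNormSq (fderiv ℝ (w τ) x)) (𝓝[Icc 0 S] t₀) (𝓝 0) := by
      have hc := hFc t₀ ht₀
      rw [ContinuousWithinAt, hF0] at hc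
      exact hc
    have h2 : Tendsto (fun τ => ENNReal.ofReal (∫ x, frobeniusNormSq (fderiv ℝ (w τ) x)))
        (𝓝[Icc 0 S] t₀) (𝓝 0) := by
      have := (ENNReal.continuous_ofReal.tendsto 0).comp h1
      rwa [ENNReal.ofReal_zero] at this
    have h3 := ((ENNReal.continuous_rpow_const (y := (1 / 2 : ℝ))).tendsto 0).comp h2
    rwa [ENNReal.zero_rpow_of_pos (by norm_num : (0 : ℝ) < 1 / 2)] at h3
  exact tendsto_of_tendsto_of_tendsto_of_le_of_le' tendsto_const_nhds hT0
    (Eventually.of_forall fun _ => bot_le) (eventually_nhdsWithin_of_forall fun τ hτ => hle τ hτ)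

/-- `t ↦ ∫‖∇U(t)‖²_{op}` is continuous on `[0,S]` along a Tao-class solution. (Proof device.)
[cite: Tao2011, Thm. 5.4 (iv)] -/
private theorem continuousOn_gradsq_of_isTaoSolutionOn {S ν : ℝ} {u₀ : E3 → E3} {U : ℝ → E3 → E3}
    {P : ℝ → E3 → ℝ} (h : IsTaoSolutionOn S ν u₀ U P) (hS : 0 < S) :
    ContinuousOn (gradsq U) (Icc 0 S) :=
  (continuousInLpOn_fderiv_of_isTaoSolutionOn h hS).continuousOn_integral_norm_sq

/-! ### Step 8 — continuity of `t ↦ ‖∇u(t)‖²_{L²}` on `[0,T)` -/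

/-- **Step 8 (p.3 l.8–9, implicit) is a THEOREM**: along every finite-energy classical solution on
`[0,T) × ℝ³` from a Clay datum, `t ↦ ‖∇u(t)‖²_{L²}` (operator norm) is continuous on `[0,T)` — below
every `S < T` the solution is Tao-class (`exists_isTaoSolutionOn_eqOn_of_slabSol`) and the gradient of a
Tao-class solution is continuous into `L²` (`continuousOn_gradsq_of_isTaoSolutionOn`). Literature-side
twin of the Summits-side
`Summit.NavierStokesRegularity.NavierStokesRegularity.Theorems.PaiLimsuwan2026.step8_GradsqCont_holds`
(p507559). [cite: PaiLimsuwan2026, (3.4) p.3 l.8–9] [cite: Tao2011, Cor. 11.1, Thm. 5.4 (iv)] -/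
theorem step8_GradsqCont_holds : Step8_GradsqCont := by
  intro ν T u₀ u p hS t ht
  set S₁ : ℝ := (t + T) / 2 with hS₁
  have htS : t < S₁ := by rw [hS₁]; linarith [ht.2]
  have hS₁T : S₁ < T := by rw [hS₁]; linarith [ht.2]
  have hS₁0 : 0 < S₁ := ht.1.trans_lt htS
  obtain ⟨U, P, hUP, hEq⟩ := exists_isTaoSolutionOn_eqOn_of_slabSol hS hS₁0 hS₁T
  have hcU : ContinuousOn (gradsq U) (Icc 0 S₁) := continuousOn_gradsq_of_isTaoSolutionOn hUP hS₁0
  have htI : t ∈ Icc 0 S₁ := ⟨ht.1, htS.le⟩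
  have hcu : ContinuousWithinAt (gradsq u) (Icc 0 S₁) t :=
    (hcU t htI).congr (fun s hs => by simp only [gradsq, hEq s hs]) (by simp only [gradsq, hEq t htI])
  exact hcu.mono_of_mem_nhdsWithin
    (mem_nhdsWithin.2 ⟨Iio S₁, isOpen_Iio, htS, fun s hs => ⟨hs.2.1, le_of_lt hs.1⟩⟩)

/-- **On the rev-2 path only the locator is left (PROVED)**: with Steps 1 and 8 discharged, the
print-grain face `Step7A_L1toL2_abs` ALONE implies Step 7, hence (A) and — with Step 9 — the claim.
[cite: PaiLimsuwan2026, (2.4)–(3.4) p.2–3] -/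
theorem step7_of_abs' (hA : Step7A_L1toL2_abs) : Step7_ExpFinite24 :=
  step7_of_abs step1_Energy24_holds step8_GradsqCont_holds hA

/-- **CLAY LINK modulo the locator alone (PROVED).** [cite: PaiLimsuwan2026, (2.4)–§4 p.2–3] -/
theorem clay_of_abs (hA : Step7A_L1toL2_abs) (h6 : Step6_Gronwall34) : clayR3.Regularity :=
  clay_of_steps h6 (step7_of_abs' hA)

end Rev3

/-! ## Rev 4 (append-only, D-0026 debt): kernel certificate for Step 2H — the enstrophy IDENTITY (3.1) p.2

`Step2H_Enstrophy31` (rev 2 (i): (3.1) read with the Hilbert–Schmidt norm `Σⱼ|∂ⱼω|²`, the norm in which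
(3.1) is an identity) is a THEOREM for the solutions typed here. Route (an assembly of tree theorems; the
template is the Grönwall step of Constantin–Fefferman, `integral_sq_norm_curl_le_of_direction_slab`):
* below every `S₁ < T` a `SlabSol` IS a Tao-class solution `U` on `[0,S₁]`
  (`exists_isTaoSolutionOn_eqOn_of_slabSol`, rev 3);
* along `U` the vorticity `ω = curl U` is jointly smooth with `ω, ∂ₜω ∈ L^∞_t L²_x` (`∂ₜω = curl ∂ₜU`,
  `IsSmoothSpaceTimeOn.curl_timeDerivWithin_of_uniqueDiffOn`; bounds from `U, ∂ₜU ∈ L^∞_t H¹_x`), so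
  `∫|ω(b)|² = ∫|ω(0)|² + ∫₀ᵇ 2∫⟪ω, ∂ₜω⟫` on `(0,S₁]` (`IsSmoothSpaceTimeOn.l2_balance`);
* at each time the vorticity equation (`IsClassicalNSSolutionOn.isVorticitySolutionOn_of_uniqueDiffOn`)
  with Green's identity and the skew-symmetry of the transport term
  (`integral_inner_curl_eq_of_vorticity_eq`, Lemarié-Rieusset 2016 (11.60)) gives
  `∫⟪ω, ∂ₜω⟫ = −ν∫|∇ω|²_F + ∫⟪ω, (∇U)ω⟫`;
* both terms are CONTINUOUS in time on `[0,S₁]` — `∫|∇ω|²_F` by `IsSmoothSpaceTimeOn.enstrophy_balance`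
  for `ω` (`ω, ∂ₜω ∈ L^∞_t H¹_x` from `U, ∂ₜU ∈ L^∞_t H²_x`), the stretching term because `ω` and `(∇U)ω`
  are continuous into `L²` (`∇U` is, rev 3; `sup|∇U| < ∞` by Sobolev) — so the fundamental theorem of
  calculus gives the derivative of `∫|ω|²` at every interior time;
* finally `⟪ω, 𝒯(U)ω⟫ = ⟪ω, (∇U)ω⟫` (the antisymmetric part of `∇U` does not stretch),
  `|∇ω|²_F = Σⱼ|∂ⱼω|²`, `𝒬 = ½∫|ω|²`, and `u = U` on the open interval `(0,S₁) ∋ t`.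
Nothing in the verdict / locator / class / statements changes; the rev-1 operator-norm twin
`Step2_Enstrophy31` stays untouched (inequality-grade, rev 2 (i)).

## References (rev 4)
* P. G. Lemarié-Rieusset, *The Navier–Stokes Problem in the 21st Century* (2016), §11.6 (11.60) and
  Thm. 11.7. [`LemarieRieusset2016`]
* T. Tao, Anal. PDE 6 (2013) = arXiv:1108.1165, Thm. 5.4 (iv), Cor. 11.1. [`Tao2011`] -/

section Rev4

open Function Topology
open scoped NNReal InnerProductSpace

/-! ### Slice identities: `⟪w, 𝒯(v)w⟫ = ⟪w, (∇v)w⟫`, `Σⱼ|∂ⱼω|² = |∇ω|²_F` -/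

/-- `⟪w, ½(A + A†)w⟫ = ⟪w, Aw⟫` for `A = ∇v(x)`: the antisymmetric part of the velocity gradient does not
stretch. (Proof device.) [folklore] -/
private theorem c136r4_inner_strain_apply (v : E3 → E3) (x w : E3) :
    inner ℝ w (strain v x w) = inner ℝ w (fderiv ℝ v x w) := by
  simp only [strain, FunLike.coe_smul, FunLike.coe_add, Pi.smul_apply, Pi.add_apply, inner_smul_right, inner_add_right, ContinuousLinearMap.adjoint_inner_right]
  rw [real_inner_comm w (fderiv ℝ v x w)]
  ring

/-- `∫ ω·(𝒯(v)ω) = ∫⟪ω, (∇v)ω⟫`. (Proof device.) [folklore] -/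
private theorem c136r4_stretchF_eq (v : E3 → E3) :
    stretchF v = ∫ x, inner ℝ (curl v x) (fderiv ℝ v x (curl v x)) := by
  unfold stretchF
  exact integral_congr_ae (ae_of_all _ fun x => c136r4_inner_strain_apply v x (curl v x))

/-- `Σⱼ‖∂ⱼω(x)‖² = |∇ω(x)|²_F`, so `vortgradsqHS u t = ∫ |∇ω(t)|²_F`. (Proof device.) [folklore] -/
private theorem c136r4_vortgradsqHS_eq (u : ℝ → E3 → E3) (t : ℝ) :
    vortgradsqHS u t = ∫ x, frobeniusNormSq (fderiv ℝ (curl (u t)) x) := by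
  unfold vortgradsqHS
  refine integral_congr_ae (ae_of_all _ fun x => ?_)
  show (∑ j : Fin 3, ‖fderiv ℝ (curl (u t)) x (EuclideanSpace.single j 1)‖ ^ 2) =
    frobeniusNormSq (fderiv ℝ (curl (u t)) x)
  rw [frobeniusNormSq_eq_sum (EuclideanSpace.basisFun (Fin 3) ℝ)]
  simp [EuclideanSpace.basisFun_apply]

/-! ### `L²` tools -/

/-- `∫⁻‖a‖ₑ² ≤ c² ∫⁻‖b‖ₑ²` when `‖a‖ ≤ c‖b‖` pointwise. (Proof device.) [folklore] -/
private theorem c136r4_lintegral_enorm_sq_le_of_norm_le_mul {α : Type*} [MeasurableSpace α]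
    {μ : Measure α} {G₁ G₂ : Type*} [NormedAddCommGroup G₁] [NormedAddCommGroup G₂] {a : α → G₁}
    {b : α → G₂} {c : ℝ} (hle : ∀ x, ‖a x‖ ≤ c * ‖b x‖) :
    ∫⁻ x, ‖a x‖ₑ ^ 2 ∂μ ≤ ENNReal.ofReal (c ^ 2) * ∫⁻ x, ‖b x‖ₑ ^ 2 ∂μ := by
  rw [← lintegral_const_mul' _ _ ENNReal.ofReal_ne_top]
  refine lintegral_mono fun x => ?_
  have h1 : ‖a x‖ₑ ^ 2 = ENNReal.ofReal (‖a x‖ ^ 2) := by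
    rw [← ofReal_norm, ENNReal.ofReal_pow (norm_nonneg _)]
  have h2 : ENNReal.ofReal (c ^ 2) * ‖b x‖ₑ ^ 2 = ENNReal.ofReal ((c * ‖b x‖) ^ 2) := by
    rw [← ofReal_norm, ← ENNReal.ofReal_pow (norm_nonneg _), ← ENNReal.ofReal_mul (sq_nonneg _),
      mul_pow]
  rw [h1, h2]
  exact ENNReal.ofReal_le_ofReal (pow_le_pow_left₀ (norm_nonneg _) ((hle x).trans_eq (by ring)) 2)

/-- `∫⁻ |D¹(curl v)|² ≤ ‖curl‖² ∫⁻ |D²v|²`. (Proof device.) [folklore] -/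
private theorem c136r4_lintegral_iteratedFDeriv_one_curl_sq_le {v : E3 → E3} (hv : ContDiff ℝ 2 v) :
    ∫⁻ x, ‖iteratedFDeriv ℝ 1 (curl v) x‖ₑ ^ 2 ≤
      ENNReal.ofReal (‖curlCLM‖ ^ 2) * ∫⁻ x, ‖iteratedFDeriv ℝ 2 v x‖ₑ ^ 2 :=
  c136r4_lintegral_enorm_sq_le_of_norm_le_mul
    (fun x => norm_iteratedFDeriv_curl_le_opNorm_mul (N := 2) hv 1 (by norm_num) x)

/-- The pairing `s ↦ ∫⟪f(s), g(s)⟫` of two fields continuous into `L²(ℝ³)` is continuous on the time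
set (continuity of the inner product of `L²` on the continuous `L²`-valued lifts). (Proof device.)
[folklore] -/
private theorem c136r4_continuousOn_integral_inner {S : Set ℝ} {f g : ℝ → E3 → E3}
    (hf : ContinuousInLpOn S 2 f) (hg : ContinuousInLpOn S 2 g) :
    ContinuousOn (fun s => ∫ x, inner ℝ (f s x) (g s x)) S := by
  obtain ⟨F, hFc, hF⟩ := hf.exists_continuousOn_toLp
  obtain ⟨G, hGc, hG⟩ := hg.exists_continuousOn_toLp
  have heq : EqOn (fun s => ∫ x, inner ℝ (f s x) (g s x)) (fun s => inner ℝ (F s) (G s)) S := by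
    intro s hs
    show (∫ x, inner ℝ (f s x) (g s x)) = inner ℝ (F s) (G s)
    rw [hF s hs, hG s hs, MeasureTheory.L2.inner_def]
    refine integral_congr_ae ?_
    filter_upwards [MemLp.coeFn_toLp (hf.1 s hs), MemLp.coeFn_toLp (hg.1 s hs)] with x hx hy
    rw [hx, hy]
  exact (hFc.inner hGc).congr heq

/-! ### Along a Tao-class solution: `ω` and `(∇U)ω` are continuous into `L²` -/

/-- Along a Tao-class solution on `[0,S]` the vorticity is continuous into `L²(ℝ³)`
(`‖curl a − curl b‖ ≤ ‖curl‖‖∇a − ∇b‖` and the `L²`-continuity of `∇U`, rev 3). (Proof device.)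
[cite: Tao2011, Thm. 5.4 (iv)] -/
private theorem c136r4_continuousInLpOn_curl {S ν : ℝ} {u₀ : E3 → E3} {U : ℝ → E3 → E3}
    {P : ℝ → E3 → ℝ} (h : IsTaoSolutionOn S ν u₀ U P) (hS : 0 < S) :
    ContinuousInLpOn (Icc 0 S) 2 (fun t x => curl (U t) x) := by
  have hD := continuousInLpOn_fderiv_of_isTaoSolutionOn h hS
  have hUc : ∀ t ∈ Icc 0 S, ContDiff ℝ ∞ (U t) := fun t ht => h.classical.contDiff_velocity ht
  have hpt : ∀ s t x, ‖curl (U s) x - curl (U t) x‖₊ ≤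
      ‖curlCLM‖₊ * ‖fderiv ℝ (U s) x - fderiv ℝ (U t) x‖₊ := fun s t x => by
    rw [curl_eq_curlCLM, curl_eq_curlCLM, ← map_sub]
    exact curlCLM.le_opNNNorm _
  refine ⟨fun t ht => ?_, fun t₀ ht₀ => ?_⟩
  · have hc : Continuous (curl (U t)) :=
      (contDiff_curl (n := 0) ((hUc t ht).of_le (by norm_cast))).continuous
    exact MemLp.of_le_mul (c := ‖curlCLM‖) (hD.1 t ht) hc.aestronglyMeasurable
      (ae_of_all _ fun x => norm_curl_le (U t) x)
  · have hle : ∀ t, eLpNorm ((fun x => curl (U t) x) - fun x => curl (U t₀) x) 2 volume ≤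
        (‖curlCLM‖₊ : ℝ≥0∞) *
          eLpNorm ((fun x => fderiv ℝ (U t) x) - fun x => fderiv ℝ (U t₀) x) 2 volume := by
      intro t
      have h1 := eLpNorm_le_nnreal_smul_eLpNorm_of_ae_le_mul
        (f := (fun x => curl (U t) x) - fun x => curl (U t₀) x)
        (g := (fun x => fderiv ℝ (U t) x) - fun x => fderiv ℝ (U t₀) x) (μ := volume)
        (ae_of_all _ fun x => hpt t t₀ x) 2
      rwa [ENNReal.smul_def, smul_eq_mul] at h1
    have hlim : Tendsto (fun t => (‖curlCLM‖₊ : ℝ≥0∞) *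
        eLpNorm ((fun x => fderiv ℝ (U t) x) - fun x => fderiv ℝ (U t₀) x) 2 volume)
        (𝓝[Icc 0 S] t₀) (𝓝 0) := by
      have := ENNReal.Tendsto.const_mul (a := (‖curlCLM‖₊ : ℝ≥0∞)) (hD.2 t₀ ht₀)
        (Or.inr ENNReal.coe_ne_top)
      rwa [mul_zero] at this
    exact tendsto_of_tendsto_of_tendsto_of_le_of_le tendsto_const_nhds hlim (fun _ => bot_le) hle

/-- Along a Tao-class solution on `[0,S]` the stretching field `x ↦ (∇U(t,x)) ω(t,x)` is continuous into
`L²(ℝ³)`: `‖(∇U)ω(s) − (∇U)ω(t₀)‖₂ ≤ sup|∇U|·‖ω(s) − ω(t₀)‖₂ + sup|ω(t₀)|·‖∇U(s) − ∇U(t₀)‖₂` with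
`sup|∇U| < ∞` (Sobolev) and the `L²`-continuity of `ω` and `∇U`. (Proof device.)
[cite: Tao2011, Thm. 5.4 (iv)] -/
private theorem c136r4_continuousInLpOn_stretchField {S ν : ℝ} {u₀ : E3 → E3} {U : ℝ → E3 → E3}
    {P : ℝ → E3 → ℝ} (h : IsTaoSolutionOn S ν u₀ U P) (hS : 0 < S) :
    ContinuousInLpOn (Icc 0 S) 2 (fun t x => fderiv ℝ (U t) x (curl (U t) x)) := by
  have hD := continuousInLpOn_fderiv_of_isTaoSolutionOn h hS
  have hω := c136r4_continuousInLpOn_curl h hS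
  have hUc : ∀ t ∈ Icc 0 S, ContDiff ℝ ∞ (U t) := fun t ht => h.classical.contDiff_velocity ht
  obtain ⟨B₁, hB₁0, hB₁⟩ := exists_forall_norm_fderiv_le_of_hasBoundedSobolevNormsOn
    (fun t ht => (hUc t ht).of_le (by norm_cast)) h.sobolev
  set κ : ℝ := ‖curlCLM‖ with hκ
  have hκ0 : 0 ≤ κ := by rw [hκ]; exact norm_nonneg curlCLM
  -- sup bound on the vorticity
  have hωsup : ∀ t ∈ Icc 0 S, ∀ x, ‖curl (U t) x‖ ≤ κ * B₁ := fun t ht x =>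
    (norm_curl_le _ _).trans (mul_le_mul_of_nonneg_left (hB₁ t ht x) hκ0)
  have hcω : ∀ t ∈ Icc 0 S, Continuous (curl (U t)) := fun t ht =>
    (contDiff_curl (n := 0) ((hUc t ht).of_le (by norm_cast))).continuous
  have hcA : ∀ t ∈ Icc 0 S, Continuous fun x => fderiv ℝ (U t) x := fun t ht =>
    (hUc t ht).continuous_fderiv (by simp)
  have hcF : ∀ t ∈ Icc 0 S, Continuous fun x => fderiv ℝ (U t) x (curl (U t) x) := fun t ht =>
    (hcA t ht).clm_apply (hcω t ht)
  refine ⟨fun t ht => ?_, fun t₀ ht₀ => ?_⟩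
  · exact MemLp.of_le_mul (c := B₁) (hω.1 t ht) (hcF t ht).aestronglyMeasurable
      (ae_of_all _ fun x => ((fderiv ℝ (U t) x).le_opNorm _).trans
        (mul_le_mul_of_nonneg_right (hB₁ t ht x) (norm_nonneg _)))
  · -- the two pieces of the difference
    set B₁' : ℝ≥0 := ⟨B₁, hB₁0⟩ with hB₁'
    set M' : ℝ≥0 := ⟨κ * B₁, mul_nonneg hκ0 hB₁0⟩ with hM'
    have hle : ∀ s ∈ Icc 0 S,
        eLpNorm ((fun x => fderiv ℝ (U s) x (curl (U s) x)) - fun x => fderiv ℝ (U t₀) x (curl (U t₀) x))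
            2 volume ≤
          (B₁' : ℝ≥0∞) * eLpNorm ((fun x => curl (U s) x) - fun x => curl (U t₀) x) 2 volume +
            (M' : ℝ≥0∞) *
              eLpNorm ((fun x => fderiv ℝ (U s) x) - fun x => fderiv ℝ (U t₀) x) 2 volume := by
      intro s hs
      -- `A(s)ω(s) − A(t₀)ω(t₀) = A(s)(ω(s) − ω(t₀)) + (A(s) − A(t₀))ω(t₀)`
      set P₁ : E3 → E3 := fun x => fderiv ℝ (U s) x (curl (U s) x - curl (U t₀) x) with hP₁
      set P₂ : E3 → E3 := fun x => (fderiv ℝ (U s) x - fderiv ℝ (U t₀) x) (curl (U t₀) x) with hP₂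
      have hsplit : ((fun x => fderiv ℝ (U s) x (curl (U s) x)) -
          fun x => fderiv ℝ (U t₀) x (curl (U t₀) x)) = P₁ + P₂ := by
        funext x
        simp only [Pi.sub_apply, Pi.add_apply, hP₁, hP₂, map_sub, sub_apply]
        abel
      have hm₁ : AEStronglyMeasurable P₁ volume :=
        ((hcA s hs).clm_apply ((hcω s hs).sub (hcω t₀ ht₀))).aestronglyMeasurable
      have hm₂ : AEStronglyMeasurable P₂ volume :=
        (((hcA s hs).sub (hcA t₀ ht₀)).clm_apply (hcω t₀ ht₀)).aestronglyMeasurable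
      have h₁ : eLpNorm P₁ 2 volume ≤
          (B₁' : ℝ≥0∞) * eLpNorm ((fun x => curl (U s) x) - fun x => curl (U t₀) x) 2 volume := by
        have h := eLpNorm_le_nnreal_smul_eLpNorm_of_ae_le_mul (f := P₁)
          (g := (fun x => curl (U s) x) - fun x => curl (U t₀) x) (μ := volume) (c := B₁')
          (ae_of_all _ fun x => by
            rw [← NNReal.coe_le_coe, NNReal.coe_mul, coe_nnnorm, coe_nnnorm]
            exact ((fderiv ℝ (U s) x).le_opNorm _).trans
              (mul_le_mul_of_nonneg_right (hB₁ s hs x) (norm_nonneg _))) 2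
        rwa [ENNReal.smul_def, smul_eq_mul] at h
      have h₂ : eLpNorm P₂ 2 volume ≤
          (M' : ℝ≥0∞) * eLpNorm ((fun x => fderiv ℝ (U s) x) - fun x => fderiv ℝ (U t₀) x) 2 volume := by
        have h := eLpNorm_le_nnreal_smul_eLpNorm_of_ae_le_mul (f := P₂)
          (g := (fun x => fderiv ℝ (U s) x) - fun x => fderiv ℝ (U t₀) x) (μ := volume) (c := M')
          (ae_of_all _ fun x => by
            rw [← NNReal.coe_le_coe, NNReal.coe_mul, coe_nnnorm, coe_nnnorm]
            calc ‖P₂ x‖ ≤ ‖fderiv ℝ (U s) x - fderiv ℝ (U t₀) x‖ * ‖curl (U t₀) x‖ :=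
                  (fderiv ℝ (U s) x - fderiv ℝ (U t₀) x).le_opNorm _
              _ ≤ ‖fderiv ℝ (U s) x - fderiv ℝ (U t₀) x‖ * (κ * B₁) :=
                  mul_le_mul_of_nonneg_left (hωsup t₀ ht₀ x) (norm_nonneg _)
              _ = (κ * B₁) * ‖((fun x => fderiv ℝ (U s) x) - fun x => fderiv ℝ (U t₀) x) x‖ := by
                  rw [mul_comm]; rfl) 2
        rwa [ENNReal.smul_def, smul_eq_mul] at h
      rw [hsplit]
      exact (eLpNorm_add_le hm₁ hm₂ (by norm_num)).trans (add_le_add h₁ h₂)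
    have hlim : Tendsto (fun s =>
        (B₁' : ℝ≥0∞) * eLpNorm ((fun x => curl (U s) x) - fun x => curl (U t₀) x) 2 volume +
          (M' : ℝ≥0∞) * eLpNorm ((fun x => fderiv ℝ (U s) x) - fun x => fderiv ℝ (U t₀) x) 2 volume)
        (𝓝[Icc 0 S] t₀) (𝓝 0) := by
      have h1 := ENNReal.Tendsto.const_mul (a := (B₁' : ℝ≥0∞)) (hω.2 t₀ ht₀)
        (Or.inr ENNReal.coe_ne_top)
      have h2 := ENNReal.Tendsto.const_mul (a := (M' : ℝ≥0∞)) (hD.2 t₀ ht₀)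
        (Or.inr ENNReal.coe_ne_top)
      have := h1.add h2
      simpa only [mul_zero, add_zero] using this
    exact tendsto_of_tendsto_of_tendsto_of_le_of_le' tendsto_const_nhds hlim
      (Eventually.of_forall fun _ => bot_le) (eventually_nhdsWithin_of_forall hle)

/-! ### The enstrophy identity along a Tao-class solution -/

/-- **`d/dt ∫|ω|² = 2(∫⟪ω, (∇U)ω⟫ − ν∫|∇ω|²_F)` at every interior time of a Tao-class solution on
`[0,S]`** (`ω = curl U`): the `L²` balance of the jointly smooth field `ω` (`IsSmoothSpaceTimeOn.l2_balance`,
`ω, ∂ₜω ∈ L^∞_t L²_x`), the vorticity equation at each slice with Green's identity and the skew-symmetry of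
the transport term (`integral_inner_curl_eq_of_vorticity_eq`), continuity in time of both right-hand
terms (`IsSmoothSpaceTimeOn.enstrophy_balance` for `ω`; `L²`-continuity of `ω` and `(∇U)ω`), and the
fundamental theorem of calculus. (Proof device.)
[cite: LemarieRieusset2016, §11.6 (11.60)] [cite: Tao2011, Thm. 5.4 (iv)] -/
private theorem c136r4_hasDerivAt_vortsq_of_isTaoSolutionOn {S ν : ℝ} {u₀ : E3 → E3}
    {U : ℝ → E3 → E3} {P : ℝ → E3 → ℝ} (h : IsTaoSolutionOn S ν u₀ U P) (hS : 0 < S) {t : ℝ}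
    (ht : t ∈ Ioo 0 S) :
    HasDerivAt (fun s => ∫ x, ‖curl (U s) x‖ ^ 2)
      (2 * ((∫ x, inner ℝ (curl (U t) x) (fderiv ℝ (U t) x (curl (U t) x))) -
        ν * ∫ x, frobeniusNormSq (fderiv ℝ (curl (U t)) x))) t := by
  have hU : UniqueDiffOn ℝ (Icc 0 S) := uniqueDiffOn_Icc hS
  have hcl := h.classical
  have hsm : ∀ s ∈ Icc 0 S, ContDiff ℝ ∞ (U s) := fun s hs => hcl.contDiff_velocity hs
  have hsm2 : ∀ s ∈ Icc 0 S, ContDiff ℝ 2 (U s) := fun s hs => (hsm s hs).of_le (by norm_cast)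
  have hsm3 : ∀ s ∈ Icc 0 S, ContDiff ℝ 3 (U s) := fun s hs => (hsm s hs).of_le (by norm_cast)
  -- sup bounds on `U`, `∇U`; Sobolev bounds
  obtain ⟨B₀, hB₀⟩ := linfty_bound_of_hasBoundedSobolevNormsOn_holds hsm2 h.sobolev
  obtain ⟨B₁, -, hB₁⟩ := exists_forall_norm_fderiv_le_of_hasBoundedSobolevNormsOn hsm3 h.sobolev
  have hfin : ∀ n, ∀ s ∈ Icc 0 S, ∫⁻ x, ‖iteratedFDeriv ℝ n (U s) x‖ₑ ^ 2 < ⊤ := fun n s hs => by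
    obtain ⟨C, hC⟩ := h.sobolev n
    exact (hC s hs).trans_lt ENNReal.coe_lt_top
  obtain ⟨C₁, hC₁⟩ := h.sobolev 1
  obtain ⟨C₂, hC₂⟩ := h.sobolev 2
  obtain ⟨D₁, hD₁⟩ := h.sobolev_dt 1
  obtain ⟨D₂, hD₂⟩ := h.sobolev_dt 2
  -- the vorticity field and its time derivative
  set vort : ℝ → E3 → E3 := vorticity U with hvort_def
  have hωt : ∀ s, vort s = curl (U s) := fun s => rfl
  have hωsm : IsSmoothSpaceTimeOn (Icc 0 S) vort := hcl.smooth_velocity.isSmoothSpaceTimeOn_vorticity hU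
  set W : ℝ → E3 → E3 := timeDerivWithin (Icc 0 S) vort with hW_def
  have hWeq : ∀ s ∈ Icc 0 S, W s = curl (timeDerivWithin (Icc 0 S) U s) := fun s hs => by
    funext x
    exact (hcl.smooth_velocity.curl_timeDerivWithin_of_uniqueDiffOn hU hs x).symm
  have hdt2 : ∀ s ∈ Icc 0 S, ContDiff ℝ 2 (timeDerivWithin (Icc 0 S) U s) := fun s hs =>
    ((hcl.smooth_velocity.timeDerivWithin hU).contDiff_slice hs).of_le (by norm_cast)
  -- `L²` bounds on `ω` and `∂ₜω`
  set κ : ℝ := ‖curlCLM‖ with hκ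
  set V₀ : ℝ≥0∞ := ENNReal.ofReal (κ ^ 2) * (C₁ : ℝ≥0∞) with hV₀
  have hV₀top : V₀ < ⊤ := ENNReal.mul_lt_top ENNReal.ofReal_lt_top ENNReal.coe_lt_top
  have hωL2 : ∀ s ∈ Icc 0 S, ∫⁻ x, ‖vort s x‖ₑ ^ 2 ≤ V₀ := fun s hs =>
    (lintegral_curl_sq_le (U s)).trans (mul_le_mul' le_rfl (hC₁ s hs))
  set V₁ : ℝ≥0∞ := ENNReal.ofReal (κ ^ 2) * (D₁ : ℝ≥0∞) with hV₁
  have hV₁top : V₁ < ⊤ := ENNReal.mul_lt_top ENNReal.ofReal_lt_top ENNReal.coe_lt_top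
  have hWL2 : ∀ s ∈ Icc 0 S, ∫⁻ x, ‖W s x‖ₑ ^ 2 ≤ V₁ := fun s hs => by
    rw [hWeq s hs]
    exact (lintegral_curl_sq_le _).trans (mul_le_mul' le_rfl (hD₁ s hs))
  -- the `L²` balance of the vorticity: `∫|ω(b)|² = ∫|ω(0)|² + ∫₀ᵇ 2∫⟪ω, ∂ₜω⟫`
  obtain ⟨-, -, hbal⟩ := hωsm.l2_balance hS (C₀ := V₀.toNNReal) (C₁ := V₁.toNNReal)
    (fun s hs => by rw [ENNReal.coe_toNNReal hV₀top.ne]; exact hωL2 s hs)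
    (fun s hs => by rw [ENNReal.coe_toNNReal hV₁top.ne]; exact hWL2 s hs)
  -- the slice identity `∫⟪ω, ∂ₜω⟫ = −ν∫|∇ω|²_F + ∫⟪ω, (∇U)ω⟫`
  have hslice : ∀ s ∈ Icc 0 S, (∫ x, inner ℝ (vort s x) (W s x)) =
      -ν * (∫ x, frobeniusNormSq (fderiv ℝ (curl (U s)) x)) +
        ∫ x, inner ℝ (curl (U s) x) (fderiv ℝ (U s) x (curl (U s) x)) := fun s hs =>
    integral_inner_curl_eq_of_vorticity_eq (hsm3 s hs) (hcl.divFree s hs)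
      ((hcl.isVorticitySolutionOn_of_uniqueDiffOn hU (fun _ _ y => curl_zero y)).vorticity_eq s hs)
      (hB₀ s hs) (hB₁ s hs) (hfin 1 s hs) (hfin 2 s hs) (hfin 3 s hs)
  -- the right-hand side and its continuity on `[0,S]`
  set G : ℝ → ℝ := fun s => ∫ x, frobeniusNormSq (fderiv ℝ (curl (U s)) x) with hG_def
  set St : ℝ → ℝ := fun s => ∫ x, inner ℝ (curl (U s) x) (fderiv ℝ (U s) x (curl (U s) x))
    with hSt_def
  set Φ : ℝ → ℝ := fun s => 2 * (St s - ν * G s) with hΦ_def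
  have hGc : ContinuousOn G (Icc 0 S) := by
    set K₁ : ℝ≥0∞ := ENNReal.ofReal (κ ^ 2) * (C₂ : ℝ≥0∞) with hK₁
    set K₂ : ℝ≥0∞ := ENNReal.ofReal (κ ^ 2) * (D₂ : ℝ≥0∞) with hK₂
    have hK₁top : K₁ < ⊤ := ENNReal.mul_lt_top ENNReal.ofReal_lt_top ENNReal.coe_lt_top
    have hK₂top : K₂ < ⊤ := ENNReal.mul_lt_top ENNReal.ofReal_lt_top ENNReal.coe_lt_top
    have h1 : ∀ s ∈ Icc 0 S, ∫⁻ x, ‖iteratedFDeriv ℝ 1 (vort s) x‖ₑ ^ 2 ≤ K₁ := fun s hs =>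
      (c136r4_lintegral_iteratedFDeriv_one_curl_sq_le (hsm2 s hs)).trans
        (mul_le_mul' le_rfl (hC₂ s hs))
    have h2 : ∀ s ∈ Icc 0 S,
        ∫⁻ x, ‖iteratedFDeriv ℝ 1 (timeDerivWithin (Icc 0 S) vort s) x‖ₑ ^ 2 ≤ K₂ := fun s hs => by
      have e : timeDerivWithin (Icc 0 S) vort s = curl (timeDerivWithin (Icc 0 S) U s) := hWeq s hs
      rw [e]
      exact (c136r4_lintegral_iteratedFDeriv_one_curl_sq_le (hdt2 s hs)).trans
        (mul_le_mul' le_rfl (hD₂ s hs))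
    obtain ⟨-, hc, -⟩ := hωsm.enstrophy_balance hS (C₁ := K₁.toNNReal) (C₂ := K₂.toNNReal)
      (fun s hs => by rw [ENNReal.coe_toNNReal hK₁top.ne]; exact h1 s hs)
      (fun s hs => by rw [ENNReal.coe_toNNReal hK₂top.ne]; exact h2 s hs)
    exact hc
  have hStc : ContinuousOn St (Icc 0 S) :=
    c136r4_continuousOn_integral_inner (c136r4_continuousInLpOn_curl h hS)
      (c136r4_continuousInLpOn_stretchField h hS)
  have hΦc : ContinuousOn Φ (Icc 0 S) :=
    continuousOn_const.mul (hStc.sub (continuousOn_const.mul hGc))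
  -- the balance in terms of `Φ`
  have hΦeq : ∀ s ∈ Icc 0 S, (∫ x, 2 * inner ℝ (vort s x) (W s x)) = Φ s := fun s hs => by
    rw [integral_const_mul, hslice s hs, hΦ_def, hSt_def, hG_def]
    ring
  set Y : ℝ → ℝ := fun s => ∫ x, ‖curl (U s) x‖ ^ 2 with hY_def
  have hYbal : ∀ b ∈ Ioc 0 S, Y b = Y 0 + ∫ τ in (0 : ℝ)..b, Φ τ := fun b hb => by
    have hI : ∫ τ in (0 : ℝ)..b, Φ τ = ∫ τ in (0 : ℝ)..b, ∫ x, 2 * inner ℝ (vort τ x) (W τ x) :=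
      intervalIntegral.integral_congr fun τ hτ => by
        rw [uIcc_of_le hb.1.le] at hτ
        exact (hΦeq τ ⟨hτ.1, hτ.2.trans hb.2⟩).symm
    rw [hI]
    exact hbal b hb
  -- the fundamental theorem of calculus at the interior time `t`
  have ht' : t ∈ Icc 0 S := Ioo_subset_Icc_self ht
  have hΦint : IntervalIntegrable Φ volume 0 t :=
    (hΦc.mono (Icc_subset_Icc_right ht.2.le)).intervalIntegrable_of_Icc ht.1.le
  have hmeas : StronglyMeasurableAtFilter Φ (𝓝 t) volume :=
    (hΦc.mono Ioo_subset_Icc_self).stronglyMeasurableAtFilter isOpen_Ioo t ht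
  have hcont : ContinuousAt Φ t := (hΦc t ht').continuousAt (Icc_mem_nhds ht.1 ht.2)
  have hD : HasDerivAt (fun s => Y 0 + ∫ τ in (0 : ℝ)..s, Φ τ) (Φ t) t :=
    (intervalIntegral.integral_hasDerivAt_right hΦint hmeas hcont).const_add (Y 0)
  have hEv : Y =ᶠ[𝓝 t] fun s => Y 0 + ∫ τ in (0 : ℝ)..s, Φ τ := by
    filter_upwards [Ioo_mem_nhds ht.1 ht.2] with s hs
    exact hYbal s ⟨hs.1, hs.2.le⟩
  exact hD.congr_of_eventuallyEq hEv

/-! ### Step 2H — the enstrophy identity (3.1) along the solutions typed here -/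

/-- **Step 2H ((3.1) p.2, Hilbert–Schmidt reading) is a THEOREM**: along every finite-energy classical
solution of the unforced system on `[0,T) × ℝ³` from a Clay datum, at every interior time `t ∈ (0,T)`,
`d/dt 𝒬(t) = ∫ ω·(𝒯(u)ω) dx − ν Σⱼ‖∂ⱼω(t)‖²_{L²}`, `𝒬 = ½‖ω‖²_{L²}` — below `S₁ = (t+T)/2` the solution
is Tao-class (`exists_isTaoSolutionOn_eqOn_of_slabSol`), the identity holds along Tao-class solutions
(`c136r4_hasDerivAt_vortsq_of_isTaoSolutionOn`: `L²` balance of the vorticity, vorticity equation,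
Green/skew-symmetry, continuity in time, FTC), `⟪ω, 𝒯ω⟫ = ⟪ω, (∇u)ω⟫` and `|∇ω|²_F = Σⱼ|∂ⱼω|²`, and
`u = U` on the open interval `(0,S₁) ∋ t`. D-0026 discharge of the rev-2 fact; off the composition
path (locator `Step7A_L1toL2_abs`, class and verdict #117 untouched).
[cite: PaiLimsuwan2026, (3.1) p.2] [cite: LemarieRieusset2016, §11.6 (11.60)] [cite: Tao2011, Thm. 5.4 (iv), Cor. 11.1] -/
theorem step2H_Enstrophy31_holds : Step2H_Enstrophy31 := by
  intro ν T u₀ u p hS t ht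
  set S₁ : ℝ := (t + T) / 2 with hS₁
  have htS : t < S₁ := by rw [hS₁]; linarith [ht.2]
  have hS₁T : S₁ < T := by rw [hS₁]; linarith [ht.2]
  have hS₁0 : 0 < S₁ := ht.1.trans htS
  obtain ⟨U, P, hUP, hEq⟩ := exists_isTaoSolutionOn_eqOn_of_slabSol hS hS₁0 hS₁T
  have hcore := c136r4_hasDerivAt_vortsq_of_isTaoSolutionOn hUP hS₁0 (t := t) ⟨ht.1, htS⟩
  -- `𝒬 = ½ ∫|ω|²`
  have hU' : HasDerivAt (enstrophy U)
      ((∫ x, inner ℝ (curl (U t) x) (fderiv ℝ (U t) x (curl (U t) x))) -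
        ν * ∫ x, frobeniusNormSq (fderiv ℝ (curl (U t)) x)) t := by
    have h2 := hcore.const_mul (1 / 2 : ℝ)
    have e : (1 / 2 : ℝ) * (2 * ((∫ x, inner ℝ (curl (U t) x) (fderiv ℝ (U t) x (curl (U t) x))) -
        ν * ∫ x, frobeniusNormSq (fderiv ℝ (curl (U t)) x))) =
        (∫ x, inner ℝ (curl (U t) x) (fderiv ℝ (U t) x (curl (U t) x))) -
          ν * ∫ x, frobeniusNormSq (fderiv ℝ (curl (U t)) x) := by ring
    rw [e] at h2
    exact h2
  -- transfer to `u` on the open interval `(0,S₁)`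
  have hEv : enstrophy u =ᶠ[𝓝 t] enstrophy U := by
    filter_upwards [Ioo_mem_nhds ht.1 htS] with s hs
    simp only [enstrophy, hEq s ⟨hs.1.le, hs.2.le⟩]
  have htI : t ∈ Icc 0 S₁ := ⟨ht.1.le, htS.le⟩
  have hst : stretch u t = stretch U t := by simp only [stretch, hEq t htI]
  have hvg : vortgradsqHS u t = vortgradsqHS U t := by simp only [vortgradsqHS, hEq t htI]
  rw [hst, hvg, stretch, c136r4_stretchF_eq, c136r4_vortgradsqHS_eq]
  exact hU'.congr_of_eventuallyEq hEv

end Rev4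

/-! ## Rev 5 (append-only, D-0026 debt): kernel certificates for Step 5C and Step 6 ((3.2)–(3.4) p.3)

With the enstrophy identity in hand (rev 4, `step2H_Enstrophy31_holds`) the two remaining TRUE links of
the printed chain are discharged for the solutions typed here:
* `Step5C_Closed33corr` (the charitable corrected closure `d/dt 𝒬 ≤ C₁(ν)‖∇u‖⁴_{L²}𝒬`): at a slice,
  `∫⟪ω,(∇u)ω⟫ ≤ ∫‖∇u‖|ω|² ≤ ‖∇u‖_{L²}‖ω‖²_{L⁴}` (Cauchy–Schwarz), the whole-space Gagliardo–Nirenberg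
  inequality `‖ω‖⁴_{L⁴} ≤ K³‖ω‖_{L²}‖∇ω‖³_{L²}` of the tree (`integral_norm_pow_four_le_of_integrable`,
  operator norm of `∇ω`) and Young's inequality in the quartic form `s⁴ ≤ XP³ ⇒ s ≤ X/(4ε³) + (3ε/4)P`
  with `ε = 4ν/3`, the dissipation `ν Σⱼ‖∂ⱼω‖²_{L²} ≥ ν‖∇ω‖²_{L²,op}` paying for the `P`-term; whence
  `C₁ = 27K⁶/(128ν³) + 1`, `K = SNormLESNormFDerivOfEqConst` (the constant of the tree's `H¹ ⊂ L⁶`);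
* `Step6_Gronwall34` ((3.4), the Grönwall inequality): `s ↦ 𝒬(s)·exp(−C₁∫₀ˢ‖∇u‖⁴_{L²})` is continuous on
  `[0,t]` (`𝒬` is continuous along Tao-class solutions, `‖∇u‖²_{L²}` by Step 8) and has non-positive
  derivative on `(0,t)` (Steps 2H and 5C), hence is antitone (`antitoneOn_of_hasDerivWithinAt_nonpos`).
On the rev-1 composition path `claim_of_steps : Step6 → Step7 → Step9 → ClaimedTheorem` /
`clay_of_steps : Step6 → Step7 → clayR3.Regularity` this leaves the adjudicated Step 7 (killed through its
print-grain face `Step7A_L1toL2_abs`, #117) and the off-path Step 9. Nothing in the verdict / locator /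
class / statements changes.

## References (rev 5)
* P. G. Lemarié-Rieusset, *The Navier–Stokes Problem in the 21st Century* (2016), Thm. 11.7 (proof:
  enstrophy, Gagliardo–Nirenberg, Young, Grönwall). [`LemarieRieusset2016`]
* T. Tao, Anal. PDE 6 (2013) = arXiv:1108.1165, Thm. 5.4 (iv), Cor. 11.1. [`Tao2011`] -/

section Rev5

open Function Topology
open scoped NNReal InnerProductSpace

/-! ### Real-variable Young step -/

/-- Polynomial AM–GM: `256ab³ ≤ (a + 3b)⁴` for `a, b ≥ 0` (`(a+3b)⁴ − 256ab³ = (a−b)²(a² + 14ab + 81b²)`).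
(Proof device.) [folklore] -/
private theorem c136r5_amgm4 {a b : ℝ} (ha : 0 ≤ a) (hb : 0 ≤ b) :
    256 * a * b ^ 3 ≤ (a + 3 * b) ^ 4 := by
  nlinarith [mul_nonneg (sq_nonneg (a - b)) (by positivity : (0 : ℝ) ≤ a ^ 2 + 14 * a * b + 81 * b ^ 2)]

/-- Young's inequality in the quartic form used for (3.3): if `s⁴ ≤ X·P³` with `X, P ≥ 0`, then
`s ≤ X/(4ε³) + (3ε/4)·P` for every `ε > 0`. (Proof device.) [folklore] -/
private theorem c136r5_young_quartic {s X P ε : ℝ} (hX : 0 ≤ X) (hP : 0 ≤ P)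
    (hε : 0 < ε) (h : s ^ 4 ≤ X * P ^ 3) : s ≤ X / (4 * ε ^ 3) + 3 * ε / 4 * P := by
  set A : ℝ := X / (4 * ε ^ 3) + 3 * ε / 4 * P with hA
  have hA0 : 0 ≤ A := by positivity
  have hag := c136r5_amgm4 (a := X / ε ^ 3) (b := ε * P) (by positivity) (by positivity)
  have e1 : 256 * (X / ε ^ 3) * (ε * P) ^ 3 = 256 * (X * P ^ 3) := by
    field_simp
  have e2 : X / ε ^ 3 + 3 * (ε * P) = 4 * A := by
    rw [hA]; field_simp
  rw [e1, e2] at hag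
  have e3 : (4 * A) ^ 4 = 256 * A ^ 4 := by ring
  have h4 : s ^ 4 ≤ A ^ 4 := by nlinarith [hag, h, e3]
  exact le_of_pow_le_pow_left₀ (by norm_num : (4 : ℕ) ≠ 0) hA0 h4

/-! ### The corrected closure at a slice -/

/-- **(3.2) + Gagliardo–Nirenberg + Young at a slice.** For a `C²` field `v : ℝ³ → ℝ³` with `∇v`
bounded and `∇v, ω = curl v, ∇ω` square integrable (operator norms):
`∫⟪ω, (∇v)ω⟫ ≤ (27K⁶/(256ν³))·(∫‖∇v‖²)²·∫|ω|² + ν∫‖∇ω‖²`, `K = SNormLESNormFDerivOfEqConst ℝ³ vol 2`.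
(Proof device.) [cite: LemarieRieusset2016, Thm. 11.7 (proof)] -/
private theorem c136r5_stretch_le {ν : ℝ} (hν : 0 < ν) {v : E3 → E3} (hv : ContDiff ℝ 2 v)
    {B₁ : ℝ} (hB₁ : ∀ x, ‖fderiv ℝ v x‖ ≤ B₁)
    (hG : Integrable (fun x => ‖fderiv ℝ v x‖ ^ 2) volume)
    (hE : Integrable (fun x => ‖curl v x‖ ^ 2) volume)
    (hP : Integrable (fun x => ‖fderiv ℝ (curl v) x‖ ^ 2) volume) :
    (∫ x, inner ℝ (curl v x) (fderiv ℝ v x (curl v x))) ≤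
      27 * (SNormLESNormFDerivOfEqConst E3 (volume : Measure E3) 2 : ℝ) ^ 6 / (256 * ν ^ 3) *
          (∫ x, ‖fderiv ℝ v x‖ ^ 2) ^ 2 * (∫ x, ‖curl v x‖ ^ 2) +
        ν * ∫ x, ‖fderiv ℝ (curl v) x‖ ^ 2 := by
  set K : ℝ := (SNormLESNormFDerivOfEqConst E3 (volume : Measure E3) 2 : ℝ) with hK
  set Gi : ℝ := ∫ x, ‖fderiv ℝ v x‖ ^ 2 with hGi
  set Ei : ℝ := ∫ x, ‖curl v x‖ ^ 2 with hEi
  set Pi : ℝ := ∫ x, ‖fderiv ℝ (curl v) x‖ ^ 2 with hPi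
  set I4 : ℝ := ∫ x, ‖curl v x‖ ^ 4 with hI4
  have hGi0 : 0 ≤ Gi := integral_nonneg fun x => by positivity
  have hEi0 : 0 ≤ Ei := integral_nonneg fun x => by positivity
  have hPi0 : 0 ≤ Pi := integral_nonneg fun x => by positivity
  have hI40 : 0 ≤ I4 := integral_nonneg fun x => by positivity
  have hB₁0 : 0 ≤ B₁ := (norm_nonneg _).trans (hB₁ 0)
  have hv1 : ContDiff ℝ 1 v := hv.of_le (by norm_num)
  have hω1 : ContDiff ℝ 1 (curl v) := contDiff_curl (n := 1) hv
  have hDc : Continuous (fderiv ℝ v) := hv1.continuous_fderiv one_ne_zero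
  have hωc : Continuous (curl v) := hω1.continuous
  -- sup bound on the vorticity
  have hωsup : ∀ x, ‖curl v x‖ ≤ ‖curlCLM‖ * B₁ := fun x =>
    (norm_curl_le _ _).trans (mul_le_mul_of_nonneg_left (hB₁ x) (norm_nonneg curlCLM))
  -- `|ω|⁴, |ω|⁶ ∈ L¹` (bounded × square integrable)
  have hI4i : Integrable (fun x => ‖curl v x‖ ^ 4) volume := by
    refine (hE.const_mul ((‖curlCLM‖ * B₁) ^ 2)).mono' ((hωc.norm.pow 4).aestronglyMeasurable)
      (ae_of_all _ fun x => ?_)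
    rw [Real.norm_eq_abs, abs_of_nonneg (by positivity)]
    have h := pow_le_pow_left₀ (norm_nonneg _) (hωsup x) 2
    nlinarith [h, sq_nonneg ‖curl v x‖]
  have hI6i : Integrable (fun x => ‖curl v x‖ ^ 6) volume := by
    refine (hE.const_mul ((‖curlCLM‖ * B₁) ^ 4)).mono' ((hωc.norm.pow 6).aestronglyMeasurable)
      (ae_of_all _ fun x => ?_)
    rw [Real.norm_eq_abs, abs_of_nonneg (by positivity)]
    have h := pow_le_pow_left₀ (norm_nonneg _) (hωsup x) 4
    nlinarith [h, sq_nonneg ‖curl v x‖, pow_nonneg (norm_nonneg (curl v x)) 4]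
  -- Gagliardo–Nirenberg (tree): `I4 ≤ K³ Ei^{1/2} Pi^{3/2}`, squared: `I4² ≤ K⁶ Ei Pi³`
  have hgn : I4 ≤ K ^ 3 * Ei ^ (1 / 2 : ℝ) * Pi ^ (3 / 2 : ℝ) :=
    integral_norm_pow_four_le_of_integrable (volume : Measure E3) finrank_euclideanSpace_fin hω1 hE
      hI6i hP
  have hgn2 : I4 ^ 2 ≤ K ^ 6 * Ei * Pi ^ 3 := by
    have h := pow_le_pow_left₀ hI40 hgn 2
    have e1 : (Ei ^ (1 / 2 : ℝ)) ^ 2 = Ei := by rw [← Real.rpow_two, ← Real.rpow_mul hEi0]; norm_num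
    have e2 : (Pi ^ (3 / 2 : ℝ)) ^ 2 = Pi ^ 3 := by rw [← Real.rpow_two, ← Real.rpow_mul hPi0]; norm_num
    calc I4 ^ 2 ≤ (K ^ 3 * Ei ^ (1 / 2 : ℝ) * Pi ^ (3 / 2 : ℝ)) ^ 2 := h
      _ = K ^ 6 * (Ei ^ (1 / 2 : ℝ)) ^ 2 * (Pi ^ (3 / 2 : ℝ)) ^ 2 := by ring
      _ = K ^ 6 * Ei * Pi ^ 3 := by rw [e1, e2]
  -- Cauchy–Schwarz: `J = ∫‖∇v‖|ω|² ≤ √Gi √I4`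
  have hcs := integral_abs_mul_le (F := fun x => ‖fderiv ℝ v x‖) (G := fun x => ‖curl v x‖ ^ 2)
    hDc.norm (hωc.norm.pow 2) (by simpa using hG)
    (hI4i.congr (ae_of_all _ fun x => by
      show ‖curl v x‖ ^ 4 = (‖curl v x‖ ^ 2) ^ 2
      ring))
  have eF : (∫ x, (fun x => ‖fderiv ℝ v x‖) x ^ 2) = Gi := rfl
  have eG : (∫ x, (fun x => ‖curl v x‖ ^ 2) x ^ 2) = I4 :=
    integral_congr_ae (ae_of_all _ fun x => by show (‖curl v x‖ ^ 2) ^ 2 = ‖curl v x‖ ^ 4; ring)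
  rw [eF, eG] at hcs
  -- the stretching integral is dominated by `J`
  have hdom : Integrable (fun x => ‖(fun x => ‖fderiv ℝ v x‖) x‖ * ‖(fun x => ‖curl v x‖ ^ 2) x‖)
      volume := by
    refine (hE.const_mul B₁).mono' ((hDc.norm.norm.mul (hωc.norm.pow 2).norm).aestronglyMeasurable)
      (ae_of_all _ fun x => ?_)
    show ‖‖‖fderiv ℝ v x‖‖ * ‖‖curl v x‖ ^ 2‖‖ ≤ B₁ * ‖curl v x‖ ^ 2
    rw [norm_mul, norm_norm, norm_norm, norm_norm, Real.norm_of_nonneg (by positivity)]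
    exact mul_le_mul_of_nonneg_right (hB₁ x) (by positivity)
  have hint : Integrable (fun x => inner ℝ (curl v x) (fderiv ℝ v x (curl v x))) volume := by
    refine (hE.const_mul B₁).mono' ((hωc.inner (hDc.clm_apply hωc)).aestronglyMeasurable)
      (ae_of_all _ fun x => ?_)
    rw [Real.norm_eq_abs]
    calc |inner ℝ (curl v x) (fderiv ℝ v x (curl v x))|
        ≤ ‖curl v x‖ * ‖fderiv ℝ v x (curl v x)‖ := abs_real_inner_le_norm _ _
      _ ≤ ‖curl v x‖ * (‖fderiv ℝ v x‖ * ‖curl v x‖) :=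
          mul_le_mul_of_nonneg_left ((fderiv ℝ v x).le_opNorm _) (norm_nonneg _)
      _ = ‖fderiv ℝ v x‖ * ‖curl v x‖ ^ 2 := by ring
      _ ≤ B₁ * ‖curl v x‖ ^ 2 := mul_le_mul_of_nonneg_right (hB₁ x) (by positivity)
  have hle1 : (∫ x, inner ℝ (curl v x) (fderiv ℝ v x (curl v x))) ≤
      ∫ x, ‖(fun x => ‖fderiv ℝ v x‖) x‖ * ‖(fun x => ‖curl v x‖ ^ 2) x‖ := by
    refine integral_mono hint hdom fun x => ?_
    show inner ℝ (curl v x) (fderiv ℝ v x (curl v x)) ≤ ‖‖fderiv ℝ v x‖‖ * ‖‖curl v x‖ ^ 2‖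
    rw [norm_norm, Real.norm_of_nonneg (by positivity)]
    calc inner ℝ (curl v x) (fderiv ℝ v x (curl v x))
        ≤ |inner ℝ (curl v x) (fderiv ℝ v x (curl v x))| := le_abs_self _
      _ ≤ ‖curl v x‖ * ‖fderiv ℝ v x (curl v x)‖ := abs_real_inner_le_norm _ _
      _ ≤ ‖curl v x‖ * (‖fderiv ℝ v x‖ * ‖curl v x‖) :=
          mul_le_mul_of_nonneg_left ((fderiv ℝ v x).le_opNorm _) (norm_nonneg _)
      _ = ‖fderiv ℝ v x‖ * ‖curl v x‖ ^ 2 := by ring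
  -- `R = √Gi √I4`, `R⁴ = Gi² I4² ≤ (K⁶ Gi² Ei) Pi³`
  set R : ℝ := Real.sqrt Gi * Real.sqrt I4 with hR
  have hR4 : R ^ 4 = Gi ^ 2 * I4 ^ 2 := by
    have e4 : ∀ a : ℝ, 0 ≤ a → Real.sqrt a ^ 4 = a ^ 2 := fun a ha => by
      rw [show (4 : ℕ) = 2 * 2 from rfl, pow_mul, Real.sq_sqrt ha]
    rw [hR, mul_pow, e4 Gi hGi0, e4 I4 hI40]
  have hR4le : R ^ 4 ≤ (K ^ 6 * Gi ^ 2 * Ei) * Pi ^ 3 := by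
    rw [hR4]
    calc Gi ^ 2 * I4 ^ 2 ≤ Gi ^ 2 * (K ^ 6 * Ei * Pi ^ 3) :=
          mul_le_mul_of_nonneg_left hgn2 (sq_nonneg _)
      _ = (K ^ 6 * Gi ^ 2 * Ei) * Pi ^ 3 := by ring
  -- Young with `ε = 4ν/3`
  have hε : 0 < 4 * ν / 3 := by positivity
  have hy := c136r5_young_quartic (by positivity) hPi0 hε hR4le
  have ey : K ^ 6 * Gi ^ 2 * Ei / (4 * (4 * ν / 3) ^ 3) + 3 * (4 * ν / 3) / 4 * Pi =
      27 * K ^ 6 / (256 * ν ^ 3) * Gi ^ 2 * Ei + ν * Pi := by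
    field_simp
    ring
  rw [ey] at hy
  exact (hle1.trans hcs).trans hy

/-! ### Step 5C — the corrected closed differential inequality -/

/-- **Step 5C ((3.2)–(3.3) p.3, charitable corrected form) is a THEOREM** with
`C₁ = 27K⁶/(128ν³) + 1`: along every finite-energy classical solution on `[0,T) × ℝ³` from a Clay datum,
at every interior time and for every derivative `D` of `𝒬` there, `D ≤ C₁‖∇u(t)‖⁴_{L²}𝒬(t)` — `D` is
the enstrophy rate of Step 2H (uniqueness of derivatives), and at the slice (Tao-class below
`S₁ = (t+T)/2`) the stretching term obeys `c136r5_stretch_le` while `ν‖∇ω‖²_{L²,op} ≤ νΣⱼ‖∂ⱼω‖²_{L²}`.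
Off the adjudicated path (locator `Step7A_L1toL2_abs`, #117 untouched).
[cite: PaiLimsuwan2026, (3.2)–(3.3) p.3] [cite: LemarieRieusset2016, Thm. 11.7 (proof)] -/
theorem step5C_Closed33corr_holds : Step5C_Closed33corr := by
  intro ν hν
  set K : ℝ := (SNormLESNormFDerivOfEqConst E3 (volume : Measure E3) 2 : ℝ) with hK
  refine ⟨27 * K ^ 6 / (128 * ν ^ 3) + 1, by positivity, ?_⟩
  intro T u₀ u p hS t ht D hD
  have hDeq : D = stretch u t - ν * vortgradsqHS u t :=
    hD.unique (step2H_Enstrophy31_holds ν T u₀ u p hS t ht)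
  -- Tao class below `S₁`
  set S₁ : ℝ := (t + T) / 2 with hS₁
  have htS : t < S₁ := by rw [hS₁]; linarith [ht.2]
  have hS₁T : S₁ < T := by rw [hS₁]; linarith [ht.2]
  have hS₁0 : 0 < S₁ := ht.1.trans htS
  obtain ⟨U, P, hUP, hEq⟩ := exists_isTaoSolutionOn_eqOn_of_slabSol hS hS₁0 hS₁T
  have htI : t ∈ Icc 0 S₁ := ⟨ht.1.le, htS.le⟩
  have hUt : u t = U t := hEq t htI
  -- slice data at `t`
  have hcl := hUP.classical
  have hv : ContDiff ℝ ∞ (U t) := hcl.contDiff_velocity htI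
  have hv2 : ContDiff ℝ 2 (U t) := hv.of_le (by norm_cast)
  have hω1 : ContDiff ℝ 1 (curl (U t)) := contDiff_curl (n := 1) hv2
  obtain ⟨B₁, -, hB₁⟩ := exists_forall_norm_fderiv_le_of_hasBoundedSobolevNormsOn
    (fun s hs => (hcl.contDiff_velocity hs).of_le (by norm_cast)) hUP.sobolev
  have hG : Integrable (fun x => ‖fderiv ℝ (U t) x‖ ^ 2) volume := hUP.integrable_norm_fderiv_sq htI
  obtain ⟨C₁', hC₁'⟩ := hUP.sobolev 1
  obtain ⟨C₂', hC₂'⟩ := hUP.sobolev 2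
  have hE : Integrable (fun x => ‖curl (U t) x‖ ^ 2) volume :=
    integrable_sq_norm_of_lintegral_lt_top hω1.continuous
      ((lintegral_curl_sq_le (U t)).trans_lt
        (ENNReal.mul_lt_top ENNReal.ofReal_lt_top ((hC₁' t htI).trans_lt ENNReal.coe_lt_top)))
  have hP : Integrable (fun x => ‖fderiv ℝ (curl (U t)) x‖ ^ 2) volume := by
    have h := integrable_sq_norm_of_lintegral_lt_top (hω1.continuous_iteratedFDeriv (m := 1) le_rfl)
      ((c136r4_lintegral_iteratedFDeriv_one_curl_sq_le hv2).trans_lt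
        (ENNReal.mul_lt_top ENNReal.ofReal_lt_top ((hC₂' t htI).trans_lt ENNReal.coe_lt_top)))
    exact h.congr (ae_of_all _ fun x => by simp only [norm_iteratedFDeriv_one])
  have hst := c136r5_stretch_le hν hv2 (hB₁ t htI) hG hE hP
  -- `∫‖∇ω‖²_op ≤ Σⱼ‖∂ⱼω‖²_{L²}`
  have hHSi : Integrable
      (fun x => ∑ j : Fin 3, ‖fderiv ℝ (curl (U t)) x (EuclideanSpace.single j 1)‖ ^ 2) volume := by
    have hcD : Continuous (fderiv ℝ (curl (U t))) := hω1.continuous_fderiv one_ne_zero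
    refine (hP.const_mul 3).mono'
      ((continuous_finsetSum _ fun j _ => ((hcD.clm_apply continuous_const).norm.pow 2)).aestronglyMeasurable)
      (ae_of_all _ fun x => ?_)
    rw [Real.norm_eq_abs, abs_of_nonneg (Finset.sum_nonneg fun j _ => by positivity)]
    have hj : ∀ j : Fin 3, ‖fderiv ℝ (curl (U t)) x (EuclideanSpace.single j 1)‖ ^ 2 ≤
        ‖fderiv ℝ (curl (U t)) x‖ ^ 2 := fun j => by
      refine pow_le_pow_left₀ (norm_nonneg _) ?_ 2
      calc ‖fderiv ℝ (curl (U t)) x (EuclideanSpace.single j 1)‖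
          ≤ ‖fderiv ℝ (curl (U t)) x‖ * ‖EuclideanSpace.single j (1 : ℝ)‖ :=
            (fderiv ℝ (curl (U t)) x).le_opNorm _
        _ = ‖fderiv ℝ (curl (U t)) x‖ := by simp
    calc ∑ j : Fin 3, ‖fderiv ℝ (curl (U t)) x (EuclideanSpace.single j 1)‖ ^ 2
        ≤ ∑ _j : Fin 3, ‖fderiv ℝ (curl (U t)) x‖ ^ 2 := Finset.sum_le_sum fun j _ => hj j
      _ = 3 * ‖fderiv ℝ (curl (U t)) x‖ ^ 2 := by simp
  have hPle : (∫ x, ‖fderiv ℝ (curl (U t)) x‖ ^ 2) ≤ vortgradsqHS U t :=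
    integral_mono hP hHSi fun x => opNorm_sq_le_sum_sq _
  -- assemble
  have hSt : stretch u t = ∫ x, inner ℝ (curl (U t) x) (fderiv ℝ (U t) x (curl (U t) x)) := by
    rw [stretch, hUt, c136r4_stretchF_eq]
  have hEn : enstrophy u t = (1 / 2) * ∫ x, ‖curl (U t) x‖ ^ 2 := by simp only [enstrophy, hUt]
  have hGr : gradsq u t = ∫ x, ‖fderiv ℝ (U t) x‖ ^ 2 := by simp only [gradsq, hUt]
  have hHS : vortgradsqHS u t = vortgradsqHS U t := by simp only [vortgradsqHS, hUt]
  rw [hDeq, hSt, hEn, hGr, hHS]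
  have hX0 : 0 ≤ (∫ x, ‖fderiv ℝ (U t) x‖ ^ 2) ^ 2 * ∫ x, ‖curl (U t) x‖ ^ 2 :=
    mul_nonneg (sq_nonneg _) (integral_nonneg fun x => by positivity)
  have hνP : ν * (∫ x, ‖fderiv ℝ (curl (U t)) x‖ ^ 2) ≤ ν * vortgradsqHS U t :=
    mul_le_mul_of_nonneg_left hPle hν.le
  have e : (27 * K ^ 6 / (128 * ν ^ 3) + 1) * (∫ x, ‖fderiv ℝ (U t) x‖ ^ 2) ^ 2 *
      ((1 / 2) * ∫ x, ‖curl (U t) x‖ ^ 2) =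
      27 * K ^ 6 / (256 * ν ^ 3) * (∫ x, ‖fderiv ℝ (U t) x‖ ^ 2) ^ 2 * (∫ x, ‖curl (U t) x‖ ^ 2) +
        (∫ x, ‖fderiv ℝ (U t) x‖ ^ 2) ^ 2 * (∫ x, ‖curl (U t) x‖ ^ 2) / 2 := by ring
  rw [e]
  linarith [hst, hνP, hX0]

/-! ### Step 6 — the Grönwall inequality (3.4) -/

/-- **Step 6 ((3.4) p.3 l.8–9, the Grönwall INEQUALITY) is a THEOREM** (with the `C₁(ν)` of Step 5C):
along every finite-energy classical solution on `[0,T) × ℝ³` from a Clay datum and every `t ∈ [0,T)`,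
`𝒬(t) ≤ 𝒬(0)·exp(C₁∫₀ᵗ‖∇u(s)‖⁴_{L²} ds)` — `s ↦ 𝒬(s)e^{−C₁∫₀ˢ‖∇u‖⁴}` is continuous on `[0,t]` (`𝒬` along
the Tao-class solution below `S₁ = (t+T)/2`; the exponent by Step 8) with non-positive derivative on
`(0,t)` (Steps 2H, 5C), hence antitone. This discharges the first hypothesis of `claim_of_steps` /
`clay_of_steps`; the adjudicated Step 7 (locator `Step7A_L1toL2_abs`, #117) is untouched.
[cite: PaiLimsuwan2026, (3.4) p.3 l.8–9] [cite: LemarieRieusset2016, Thm. 11.7 (proof, Grönwall)] -/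
theorem step6_Gronwall34_holds : Step6_Gronwall34 := by
  intro ν hν
  obtain ⟨C₁, hC₁, h5⟩ := step5C_Closed33corr_holds ν hν
  refine ⟨C₁, hC₁, fun T u₀ u p hS t ht => ?_⟩
  rcases ht.1.eq_or_lt with h0 | ht0
  · subst h0
    simp [intervalIntegral.integral_same]
  set Q : ℝ → ℝ := enstrophy u with hQ
  set g : ℝ → ℝ := gradsq u with hg
  set Φ : ℝ → ℝ := fun s => C₁ * ∫ τ in (0 : ℝ)..s, g τ ^ 2 with hΦ
  -- continuity of `‖∇u‖²_{L²}` on `[0,T)` (Step 8) and of `𝒬` on `[0,t]` (Tao class below `S₁`)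
  have hgc : ContinuousOn g (Ico 0 T) := step8_GradsqCont_holds ν T u₀ u p hS
  set S₁ : ℝ := (t + T) / 2 with hS₁
  have htS : t < S₁ := by rw [hS₁]; linarith [ht.2]
  have hS₁T : S₁ < T := by rw [hS₁]; linarith [ht.2]
  have hS₁0 : 0 < S₁ := ht0.trans htS
  obtain ⟨U, P, hUP, hEq⟩ := exists_isTaoSolutionOn_eqOn_of_slabSol hS hS₁0 hS₁T
  have hQc : ContinuousOn Q (Icc 0 t) := by
    have hc := (c136r4_continuousInLpOn_curl hUP hS₁0).continuousOn_integral_norm_sq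
    have hc' : ContinuousOn (fun s => (1 / 2 : ℝ) * ∫ x, ‖curl (U s) x‖ ^ 2) (Icc 0 t) :=
      (continuousOn_const.mul hc).mono (Icc_subset_Icc_right htS.le)
    refine hc'.congr fun s hs => ?_
    show enstrophy u s = (1 / 2 : ℝ) * ∫ x, ‖curl (U s) x‖ ^ 2
    simp only [enstrophy, hEq s ⟨hs.1, hs.2.trans htS.le⟩]
  -- the exponent: continuity on `[0,t]`, derivative on `(0,t)`
  have htT : Icc 0 t ⊆ Ico 0 T := fun s hs => ⟨hs.1, hs.2.trans_lt ht.2⟩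
  have hg2c : ContinuousOn (fun τ => g τ ^ 2) (Icc 0 t) := (hgc.mono htT).pow 2
  have hΦc : ContinuousOn Φ (Icc 0 t) := by
    have h := intervalIntegral.continuousOn_primitive_interval (μ := volume) (a := 0) (b := t)
      (f := fun τ => g τ ^ 2) (by rw [uIcc_of_le ht0.le]; exact hg2c.integrableOn_Icc)
    rw [uIcc_of_le ht0.le] at h
    exact continuousOn_const.mul h
  have hΦd : ∀ s ∈ Ioo 0 t, HasDerivAt Φ (C₁ * g s ^ 2) s := fun s hs => by
    have hsT : s ∈ Ioo 0 T := ⟨hs.1, hs.2.trans ht.2⟩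
    have hint : IntervalIntegrable (fun τ => g τ ^ 2) volume 0 s :=
      (hg2c.mono (Icc_subset_Icc_right hs.2.le)).intervalIntegrable_of_Icc hs.1.le
    have hmeas : StronglyMeasurableAtFilter (fun τ => g τ ^ 2) (𝓝 s) volume :=
      ((hgc.mono Ioo_subset_Ico_self).pow 2).stronglyMeasurableAtFilter isOpen_Ioo s hsT
    have hca : ContinuousAt (fun τ => g τ ^ 2) s :=
      ((hgc.pow 2) s (Ioo_subset_Ico_self hsT)).continuousAt (Ico_mem_nhds hsT.1 hsT.2)
    exact (intervalIntegral.integral_hasDerivAt_right hint hmeas hca).const_mul C₁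
  -- `s ↦ 𝒬(s) e^{−Φ(s)}` is antitone on `[0,t]`
  have hanti : AntitoneOn (fun s => Q s * Real.exp (-Φ s)) (Icc 0 t) := by
    refine antitoneOn_of_hasDerivWithinAt_nonpos (convex_Icc 0 t)
      (hQc.mul (hΦc.neg.rexp))
      (f' := fun s => Real.exp (-Φ s) * ((stretch u s - ν * vortgradsqHS u s) - C₁ * g s ^ 2 * Q s))
      (fun s hs => ?_) (fun s hs => ?_)
    · rw [interior_Icc] at hs
      have hsT : s ∈ Ioo 0 T := ⟨hs.1, hs.2.trans ht.2⟩
      have hQd : HasDerivAt Q (stretch u s - ν * vortgradsqHS u s) s :=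
        step2H_Enstrophy31_holds ν T u₀ u p hS s hsT
      have hexp : HasDerivAt (fun τ => Real.exp (-Φ τ)) (Real.exp (-Φ s) * (-(C₁ * g s ^ 2))) s :=
        (hΦd s hs).neg.exp
      refine ((hQd.mul hexp).hasDerivWithinAt).congr_deriv ?_
      ring
    · rw [interior_Icc] at hs
      have hsT : s ∈ Ioo 0 T := ⟨hs.1, hs.2.trans ht.2⟩
      have h5s : stretch u s - ν * vortgradsqHS u s ≤ C₁ * gradsq u s ^ 2 * enstrophy u s :=
        h5 T u₀ u p hS s hsT _ (step2H_Enstrophy31_holds ν T u₀ u p hS s hsT)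
      exact mul_nonpos_iff.2 (Or.inl ⟨Real.exp_nonneg _, sub_nonpos.2 h5s⟩)
  have hmono := hanti (left_mem_Icc.2 ht0.le) (right_mem_Icc.2 ht0.le) ht0.le
  -- unfold at the endpoints
  have hΦ0 : Φ 0 = 0 := by simp [hΦ, intervalIntegral.integral_same]
  have h' : Q t * Real.exp (-Φ t) ≤ Q 0 := by simpa [hΦ0] using hmono
  rw [Real.exp_neg, mul_inv_le_iff₀ (Real.exp_pos _)] at h'
  exact h'

end Rev5

/-! ## Step 9 (decay) discharged — Masuda 1984 / Kato 1984 in the tree -/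

/-- **Step 9 HOLDS — kernel** (§4 item 3 p.3 «Decay Property: `lim_{t→∞} ‖u(t)‖_{ℒ²} = 0`»): for `ν > 0`, a Clay
datum and `(u, p)` smooth on the closed half-space solving the unforced system with bounded energy,
`∫ |u(t,x)|² dx → 0` — Masuda 1984 Thm. 2 / Kato 1984 §4 for this class, a tree THEOREM
(`Literature.Analysis.FluidPDE.IsNavierStokesSolution.tendsto_integral_norm_sq_atTop`; no rate). The
smoothness and divergence-freeness of the datum are not used beyond what `IsNavierStokesSolution` carries.
[cite: PaiLimsuwan2026, §4 item 3 p.3] [cite: Masuda1984, Thm. 2] -/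
theorem step9_Decay_holds : Step9_Decay := by
  intro ν hν u₀ u p _ _ hdec hus hps hns hE
  exact hns.tendsto_integral_norm_sq_atTop hν hdec hus hps hE

/-- `Step9_Decay` — `_holds` alias of `step9_Decay_holds` above under the fact's exact name (appended
2026-08-28, D-0026 bookkeeping: the proof term is the existing theorem of this file; no statement,
definition or attribute is edited; no new named fact; the ledger's debt table listed the fact
unproved). [cite: Masuda1984, Thm. 2] -/
theorem _root_.Literature.Claims.NS.PaiLimsuwan2026.Step9_Decay_holds : Step9_Decay :=
  _root_.Literature.Claims.NS.PaiLimsuwan2026.step9_Decay_holds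

end Literature.Claims.NS.PaiLimsuwan2026
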